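import Literature.Analysis.FluidPDE.CKNDuhamelRepresentation
import Literature.Analysis.FluidPDE.CKNDuhamelDataClasses
import Literature.Analysis.FluidPDE.HeatPotentialFarField
import Mathlib.Analysis.Distribution.AEEqOfIntegralContDiff
import HarnessLib

/-!
# Discharge of `lemma13_6_duhamel` (Lemarié-Rieusset 2016, Lemma 13.6: the localised Duhamel formula)

Sibling proof file of `CKNMorreyHolder.lean` (D-0014): it proves
`LemarieRieusset2016.lemma13_6_duhamel_holds : lemma13_6_duhamel`.

The printed proof (§13.9 Step 3, (13.50)–(13.52), and pp. 477–478) localises `u` with a cut-off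
and writes `φu` as a Duhamel integral of data in parabolic Morrey classes. The formalised route is
the kernel-localised (Seregin–Šverák) form of the same computation: the duality identity
`CKNMorreyDualIdentity.integral_cutoff_mul_test_mul_inner_eq_nu` tested with an arbitrary `θ`
supported in `Q_{r₃}` (`CKNDuhamelRepresentation.duhamel_pairing_identity`) expresses `∫ θ u_k`
through forward potentials of explicit data; their Morrey classes are those printed on p. 478
(`CKNDuhamelDataClasses`, `MorreyDataClasses`); the cut-off pressure terms (supported in the
annulus where `∇φ ≠ 0`) are smooth near `Q̄_{r₃}` (`HeatPotentialFarField`) hence parabolically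
Lipschitz there (`CKNDuhamelSetup`); and the tested identity for all `θ` gives the pointwise a.e.
representation (`IsOpen.ae_eq_zero_of_integral_contDiff_smul_eq_zero`).

## References

* P. G. Lemarié-Rieusset, *The Navier–Stokes Problem in the 21st Century*, CRC Press (2016),
  §13.9 Step 3 (13.50)–(13.52) pp. 474–475; Lemma 13.6 and its proof pp. 477–478. [LemarieRieusset2016]
* G. Seregin, V. Šverák, Comm. PDE 34 (2009) = arXiv:0804.1803, §2 (the caloric duality
  argument). [SereginSverak2009]
-/

noncomputable section

open MeasureTheory Set Function Filter Metric Real ContinuousLinearMap TopologicalSpace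
open scoped ENNReal NNReal Topology RealInnerProductSpace Convolution Laplacian

namespace Literature.Analysis.FluidPDE

namespace LemarieRieusset2016

/-! ### Small helpers -/

/-- Re-indexing a family over `Unit ⊕ Fin 3 ⊕ Unit ⊕ Unit ⊕ (Fin 3 × Fin 3)` by `Fin 15`. [folklore] -/
theorem card_heatIndex :
    Fintype.card (Unit ⊕ (Fin 3 ⊕ (Unit ⊕ (Unit ⊕ Fin 3 × Fin 3)))) = 15 := by
  simp

/-- Re-indexing a family over `Fin 3 ⊕ Fin 3 ⊕ (Fin 3 × Fin 3)` by `Fin 15`. [folklore] -/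
theorem card_multIndex : Fintype.card (Fin 3 ⊕ (Fin 3 ⊕ Fin 3 × Fin 3)) = 15 := by
  simp

/-- A locally integrable function times a test function is integrable. [folklore] -/
theorem integrable_test_mul {P : ℝ × EuclideanSpace ℝ (Fin 3) → ℝ} (hP : LocallyIntegrable P volume)
    {θ : ℝ → EuclideanSpace ℝ (Fin 3) → ℝ}
    (hθ : IsSpaceTimeTestOn (⊤ : Opens (ℝ × EuclideanSpace ℝ (Fin 3))) θ) :
    Integrable (fun w : ℝ × EuclideanSpace ℝ (Fin 3) => θ w.1 w.2 * P w) volume := by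
  have h := hP.integrable_smul_left_of_hasCompactSupport hθ.contDiff.continuous hθ.hasCompactSupport
  simpa [smul_eq_mul, uncurry] using h

/-- A function continuous on an open set `U` times a test function supported in `U` is integrable.
[folklore] -/
theorem integrable_test_mul_of_continuousOn {P : ℝ × EuclideanSpace ℝ (Fin 3) → ℝ}
    {U : Set (ℝ × EuclideanSpace ℝ (Fin 3))} (hP : ContinuousOn P U)
    {θ : ℝ → EuclideanSpace ℝ (Fin 3) → ℝ}
    (hθ : IsSpaceTimeTestOn (⊤ : Opens (ℝ × EuclideanSpace ℝ (Fin 3))) θ)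
    (hθU : tsupport (uncurry θ) ⊆ U) :
    Integrable (fun w : ℝ × EuclideanSpace ℝ (Fin 3) => θ w.1 w.2 * P w) volume := by
  have hc : ContinuousOn (fun w : ℝ × EuclideanSpace ℝ (Fin 3) => θ w.1 w.2 * P w) (tsupport (uncurry θ)) :=
    (hθ.contDiff.continuous.continuousOn).mul (hP.mono hθU)
  have hi : IntegrableOn (fun w : ℝ × EuclideanSpace ℝ (Fin 3) => θ w.1 w.2 * P w) (tsupport (uncurry θ)) volume :=
    hc.integrableOn_compact hθ.hasCompactSupport
  refine (integrableOn_iff_integrable_of_support_subset ?_).1 hi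
  intro w hw
  have : θ w.1 w.2 ≠ 0 := fun h => hw (by simp [h])
  exact subset_tsupport _ (show w ∈ support (uncurry θ) from this)

/-! ### The discharge -/

set_option maxHeartbeats 4000000 in
/-- **Lemma 13.6, the localised Duhamel representation** (`lemma13_6_duhamel`): on `Q_{r₃}` the
component `u_k` is a.e. the real part of fifteen heat potentials and fifteen multiplier heat
potentials of data in the printed Morrey classes, plus a parabolically Lipschitz remainder (the
kernel-localised cut-off pressure terms). [cite: LemarieRieusset2016, §13.9 Step 3 (13.50)–(13.52) pp. 474–475; Lemma 13.6 proof pp. 477–478] -/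
theorem lemma13_6_duhamel_holds : lemma13_6_duhamel := by
  intro ν q₀ τ₀ τ₂ σ Ω f u p G z₀ r₂ hν hq₀ hq₀' hτ₀ hτ₂ hσ hστ hr₂ hS hΩ hfM huM huσ _hGM r₃ hr₃ hr₃₂ k
  classical
  /- ### radii -/
  set ρ₁ : ℝ := (2 * r₃ + r₂) / 3 with hρ₁_def
  set ρ₂ : ℝ := (r₃ + 2 * r₂) / 3 with hρ₂_def
  have hρ₁ : r₃ < ρ₁ := by rw [hρ₁_def]; linarith
  have hρ₁₂ : ρ₁ < ρ₂ := by rw [hρ₁_def, hρ₂_def]; linarith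
  have hρ₂ : ρ₂ < r₂ := by rw [hρ₂_def]; linarith
  have hρ₁0 : 0 < ρ₁ := hr₃.trans hρ₁
  have hρ₂0 : 0 < ρ₂ := hρ₁0.trans hρ₁₂
  set δ : ℝ := ρ₁ - r₃ with hδ_def
  have hδ : 0 < δ := by rw [hδ_def]; linarith
  set r₀ : ℝ := δ / 16 with hr₀_def
  set r₁ : ℝ := δ / 8 with hr₁_def
  have h₀ : 0 < r₀ := by positivity
  have h₁ : r₀ < r₁ := by rw [hr₀_def, hr₁_def]; linarith
  set T : ℝ := z₀.1 - r₂ ^ 2 with hT_def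
  /- ### cylinders, boxes, the cut-off -/
  set Q₂ : Set (ℝ × EuclideanSpace ℝ (Fin 3)) := FluidPDE.parabolicCylinderCentered r₂ z₀ with hQ₂_def
  set Q₃ : Set (ℝ × EuclideanSpace ℝ (Fin 3)) := FluidPDE.parabolicCylinderCentered r₃ z₀ with hQ₃_def
  have hQ₂m : MeasurableSet Q₂ := (FluidPDE.isOpen_parabolicCylinderCentered r₂ z₀).measurableSet
  have hQ₃o : IsOpen Q₃ := FluidPDE.isOpen_parabolicCylinderCentered r₃ z₀
  have hQ₃Q₂ : Q₃ ⊆ Q₂ := FluidPDE.parabolicCylinderCentered_mono hr₃.le hr₃₂.le z₀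
  have hQ₂Ω : Q₂ ⊆ (Ω : Set (ℝ × EuclideanSpace ℝ (Fin 3))) := hΩ
  have hQ₃Ω : Q₃ ⊆ (Ω : Set (ℝ × EuclideanSpace ℝ (Fin 3))) := hQ₃Q₂.trans hQ₂Ω
  set Kbox : Set (ℝ × EuclideanSpace ℝ (Fin 3)) := closedBall z₀.1 (ρ₂ ^ 2) ×ˢ closedBall z₀.2 ρ₂
    with hKbox_def
  have hKboxQ₂ : Kbox ⊆ Q₂ := closedBox_subset_parabolicCylinderCentered hρ₂0.le hρ₂ z₀
  obtain ⟨φ, hφT, hφ01, hφK, hone, hflat⟩ := exists_product_cutoff_spatial z₀ hρ₁0 hρ₁₂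
  set K : Set (ℝ × EuclideanSpace ℝ (Fin 3)) := tsupport (uncurry φ) with hK_def
  have hKc : IsCompact K := hφT.hasCompactSupport
  have hKQ₂ : K ⊆ Q₂ := hφK.trans hKboxQ₂
  have hKΩ : K ⊆ (Ω : Set (ℝ × EuclideanSpace ℝ (Fin 3))) := hKQ₂.trans hQ₂Ω
  have hKt : ∀ z ∈ K, z.1 ∈ Icc (z₀.1 - ρ₂ ^ 2) (z₀.1 + ρ₂ ^ 2) := by
    intro z hz
    have h := (hφK hz).1
    rw [mem_closedBall, Real.dist_eq, abs_le] at h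
    exact ⟨by linarith, by linarith⟩
  have hKT : ∀ z : ℝ × EuclideanSpace ℝ (Fin 3), z.1 ≤ T → z ∉ K := by
    intro z hz hzK
    have h := (hKt z hzK).1
    have hsq : ρ₂ ^ 2 < r₂ ^ 2 := by nlinarith
    rw [hT_def] at hz
    linarith
  have hKx : ∀ z ∈ K, z.2 ∈ closedBall z₀.2 ρ₂ := fun z hz => (hφK hz).2
  have zφ : ∀ z : ℝ × EuclideanSpace ℝ (Fin 3), z ∉ K → φ z.1 z.2 = 0 := fun z hz =>
    show uncurry φ z = 0 from image_eq_zero_of_notMem_tsupport hz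
  -- the standard frame and the component
  set b : OrthonormalBasis (Fin 3) ℝ (EuclideanSpace ℝ (Fin 3)) := EuclideanSpace.basisFun (Fin 3) ℝ
    with hb_def
  set c : EuclideanSpace ℝ (Fin 3) := b k with hc_def
  have hb1 : ∀ i, ‖b i‖ ≤ 1 := fun i => (b.orthonormal.1 i).le
  have hc1 : ‖c‖ ≤ 1 := hb1 k
  /- ### the solution data and their modifications -/
  have hns := hS.solution
  have hu := hns.1
  have hu2 := hns.2.1
  have hp := hns.2.2.1
  have hfloc : LocallyIntegrableOn (uncurry f) (Ω : Set (ℝ × EuclideanSpace ℝ (Fin 3))) volume :=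
    locallyIntegrableOn_of_locallyIntegrable_restrict
      (hS.force_memLp.locallyIntegrable (ENNReal.one_le_ofReal.2 (by norm_num)))
  have hdivf : ∀ φ' : ℝ → EuclideanSpace ℝ (Fin 3) → ℝ, IsSpaceTimeTestOn Ω φ' →
      ∫ z in (Ω : Set (ℝ × EuclideanSpace ℝ (Fin 3))), ⟪f z.1 z.2, gradient (φ' z.1) z.2⟫ = 0 :=
    fun φ' hφ' => setIntegral_inner_gradient_eq_zero_of_iterated hfloc hS.divFree_force hφ'
  have hΩm : MeasurableSet (Ω : Set (ℝ × EuclideanSpace ℝ (Fin 3))) := Ω.isOpen.measurableSet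
  have hu_ae : AEStronglyMeasurable (uncurry u) (volume.restrict (Ω : Set (ℝ × EuclideanSpace ℝ (Fin 3)))) :=
    hu.aestronglyMeasurable
  have hp_ae : AEStronglyMeasurable (uncurry p) (volume.restrict (Ω : Set (ℝ × EuclideanSpace ℝ (Fin 3)))) :=
    hp.aestronglyMeasurable
  have hf_ae : AEStronglyMeasurable (uncurry f) (volume.restrict (Ω : Set (ℝ × EuclideanSpace ℝ (Fin 3)))) :=
    hS.force_memLp.1
  set ut : ℝ × EuclideanSpace ℝ (Fin 3) → EuclideanSpace ℝ (Fin 3) := hu_ae.mk (uncurry u) with hut_def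
  set pt : ℝ × EuclideanSpace ℝ (Fin 3) → ℝ := hp_ae.mk (uncurry p) with hpt_def
  set ft : ℝ × EuclideanSpace ℝ (Fin 3) → EuclideanSpace ℝ (Fin 3) := hf_ae.mk (uncurry f) with hft_def
  have hutm : Measurable ut := hu_ae.stronglyMeasurable_mk.measurable
  have hptm : Measurable pt := hp_ae.stronglyMeasurable_mk.measurable
  have hftm : Measurable ft := hf_ae.stronglyMeasurable_mk.measurable
  have hut : ∀ᵐ z ∂(volume.restrict (Ω : Set (ℝ × EuclideanSpace ℝ (Fin 3)))), u z.1 z.2 = ut z := by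
    filter_upwards [hu_ae.ae_eq_mk] with z hz
    exact hz
  have hpt : ∀ᵐ z ∂(volume.restrict (Ω : Set (ℝ × EuclideanSpace ℝ (Fin 3)))), p z.1 z.2 = pt z := by
    filter_upwards [hp_ae.ae_eq_mk] with z hz
    exact hz
  have hft : ∀ᵐ z ∂(volume.restrict (Ω : Set (ℝ × EuclideanSpace ℝ (Fin 3)))), f z.1 z.2 = ft z := by
    filter_upwards [hf_ae.ae_eq_mk] with z hz
    exact hz
  /- ### Morrey classes of the modifications -/
  have aeQ₂ : ∀ {P : ℝ × EuclideanSpace ℝ (Fin 3) → Prop},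
      (∀ᵐ z ∂(volume.restrict (Ω : Set (ℝ × EuclideanSpace ℝ (Fin 3)))), P z) →
        ∀ᵐ z ∂(volume.restrict Q₂), P z :=
    fun h => ae_mono (Measure.restrict_mono hQ₂Ω le_rfl) h
  have morU : IsParabolicMorreyOn Q₂ (fun w => ‖ut w‖ₑ) 3 τ₂ :=
    huM.congr_ae (by norm_num) (by filter_upwards [aeQ₂ hut] with z hz; rw [hz])
  have morUσ : IsParabolicMorreyOn Q₂ (fun w => ‖ut w‖ₑ) 3 σ :=
    huσ.congr_ae (by norm_num) (by filter_upwards [aeQ₂ hut] with z hz; rw [hz])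
  have morF : IsParabolicMorreyOn Q₂ (fun w => ‖ft w‖ₑ) (10 / 7) τ₀ :=
    hfM.congr_ae (by norm_num) (by filter_upwards [aeQ₂ hft] with z hz; rw [hz])
  -- the exponent of the products
  set ρ' : ℝ := (τ₂⁻¹ + σ⁻¹)⁻¹ with hρ'_def
  have hτ₂0 : 0 < τ₂ := by linarith
  have hρ'inv : ρ'⁻¹ = τ₂⁻¹ + σ⁻¹ := by rw [hρ'_def, inv_inv]
  have hρ'5 : 5 < ρ' := by
    have h1 : τ₂⁻¹ + σ⁻¹ < 5⁻¹ := by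
      have := hστ
      rw [one_div, one_div, one_div] at this
      linarith
    have h2 : 0 < τ₂⁻¹ + σ⁻¹ := by positivity
    rw [hρ'_def]
    calc (5 : ℝ) = (5⁻¹)⁻¹ := by norm_num
      _ < (τ₂⁻¹ + σ⁻¹)⁻¹ := by
          apply inv_strictAnti₀ h2 h1
  have hρ'0 : 0 < ρ' := by linarith
  have hutme : AEMeasurable (fun w : ℝ × EuclideanSpace ℝ (Fin 3) => ‖ut w‖ₑ) volume :=
    hutm.enorm.aemeasurable
  have morUU : IsParabolicMorreyOn Q₂ (fun w => ‖ut w‖ₑ * ‖ut w‖ₑ) (3 / 2) ρ' := by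
    refine morU.mul morUσ hutme hutme ⟨by norm_num, by norm_num, by norm_num⟩ ?_
    rw [div_eq_mul_inv, div_eq_mul_inv, div_eq_mul_inv, hρ'inv]
    ring
  -- finite third moment of `ũ` on `Q₂` and finite `q₀`-moment of `p̃` on `K`
  have hU3 : ∫⁻ w in Q₂, ‖ut w‖ₑ ^ (3 : ℝ) < ∞ := morU.setLIntegral_rpow_lt_top subset_rfl hr₂
  have aeK : ∀ {P : ℝ × EuclideanSpace ℝ (Fin 3) → Prop},
      (∀ᵐ z ∂(volume.restrict (Ω : Set (ℝ × EuclideanSpace ℝ (Fin 3)))), P z) →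
        ∀ᵐ z ∂(volume.restrict K), P z :=
    fun h => ae_mono (Measure.restrict_mono hKΩ le_rfl) h
  have hPq : ∫⁻ w in K, ‖pt w‖ₑ ^ q₀ < ∞ := by
    have h1 : ∫⁻ w in K, ‖pt w‖ₑ ^ q₀ = ∫⁻ w in K, ‖p w.1 w.2‖ₑ ^ q₀ := by
      refine lintegral_congr_ae ?_
      filter_upwards [aeK hpt] with z hz
      rw [hz]
    rw [h1]
    exact (lintegral_mono_set hKΩ).trans_lt hS.pressure_lt_top
  /- ### bounds for the cut-off and its derivatives -/
  obtain ⟨Mt, hMt0, hMt⟩ := hφT.timeDeriv_top.exists_norm_le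
  obtain ⟨MΔ, hMΔ0, hMΔ⟩ := hφT.laplacian_top.exists_norm_le
  have hM1ex : ∀ i : Fin 3, ∃ M : ℝ, 0 ≤ M ∧ ∀ t x, ‖fderiv ℝ (φ t) x (b i)‖ ≤ M := fun i =>
    (hφT.fderiv_apply_top (b i)).exists_norm_le
  choose M1 hM10 hM1 using hM1ex
  have eφ : ∀ z : ℝ × EuclideanSpace ℝ (Fin 3), ‖φ z.1 z.2‖ₑ ≤ ENNReal.ofReal 1 := fun z =>
    enorm_le_ofReal_of_abs_le (by rw [abs_of_nonneg (hφ01 z.1 z.2).1]; exact (hφ01 z.1 z.2).2)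
  have eφ' : ∀ z : ℝ × EuclideanSpace ℝ (Fin 3), ‖-φ z.1 z.2‖ₑ ≤ ENNReal.ofReal 1 := fun z => by
    rw [enorm_neg]; exact eφ z
  have eT1 : ∀ z : ℝ × EuclideanSpace ℝ (Fin 3),
      ‖timeDeriv φ z.1 z.2 + ν * (Δ (φ z.1)) z.2‖ₑ ≤ ENNReal.ofReal (Mt + ν * MΔ) := fun z => by
    refine enorm_le_ofReal_of_abs_le ?_
    calc |timeDeriv φ z.1 z.2 + ν * (Δ (φ z.1)) z.2|
        ≤ |timeDeriv φ z.1 z.2| + |ν * (Δ (φ z.1)) z.2| := abs_add_le _ _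
      _ ≤ Mt + ν * MΔ := by
          rw [abs_mul, abs_of_pos hν]
          have h1 := hMt z.1 z.2
          have h2 := hMΔ z.1 z.2
          rw [Real.norm_eq_abs] at h1 h2
          exact add_le_add h1 (mul_le_mul_of_nonneg_left h2 hν.le)
  have eT2 : ∀ (i : Fin 3) (z : ℝ × EuclideanSpace ℝ (Fin 3)),
      ‖-(2 * ν * fderiv ℝ (φ z.1) z.2 (b i))‖ₑ ≤ ENNReal.ofReal (2 * ν * M1 i) := fun i z => by
    rw [enorm_neg]
    refine enorm_le_ofReal_of_abs_le ?_
    rw [abs_mul, abs_of_pos (by positivity : (0 : ℝ) < 2 * ν)]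
    have h1 := hM1 i z.1 z.2
    rw [Real.norm_eq_abs] at h1
    exact mul_le_mul_of_nonneg_left h1 (by positivity)
  have eT3 : ∀ (i : Fin 3) (z : ℝ × EuclideanSpace ℝ (Fin 3)),
      ‖fderiv ℝ (φ z.1) z.2 (b i)‖ₑ ≤ ENNReal.ofReal (M1 i) := fun i z => by
    refine enorm_le_ofReal_of_abs_le ?_
    have h1 := hM1 i z.1 z.2
    rwa [Real.norm_eq_abs] at h1
  -- vanishing of the derivatives off `K`
  have zφt : ∀ z : ℝ × EuclideanSpace ℝ (Fin 3), z ∉ K →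
      timeDeriv φ z.1 z.2 + ν * (Δ (φ z.1)) z.2 = 0 := fun z hz => by
    rw [IsSpaceTimeTestOn.timeDeriv_eq_zero_of_notMem hz, laplacian_slice_eq_zero_of_notMem_tsupport hz,
      mul_zero, add_zero]
  have zφi : ∀ (v : EuclideanSpace ℝ (Fin 3)) (z : ℝ × EuclideanSpace ℝ (Fin 3)), z ∉ K →
      fderiv ℝ (φ z.1) z.2 v = 0 := fun v z hz => by
    rw [IsSpaceTimeTestOn.fderiv_slice_eq_zero_of_notMem hz]; rfl
  /- ### a generic Morrey criterion for localised data -/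
  have CLS : ∀ (D : ℝ × EuclideanSpace ℝ (Fin 3) → ℝ) (X : ℝ × EuclideanSpace ℝ (Fin 3) → ℝ≥0∞)
      (q τ C : ℝ), IsParabolicMorreyOn Q₂ X q τ → 0 < q →
      (∀ w, ‖D w‖ₑ ≤ ENNReal.ofReal C * X w) → (∀ w, w ∉ K → D w = 0) →
      IsParabolicMorreyOn univ (fun w => ‖D w‖ₑ) q τ := by
    intro D X q τ C hX hq hle hD0
    refine isParabolicMorreyOn_univ_of_le_indicator_mul hX hQ₂m hq (C := ENNReal.ofReal C)
      ENNReal.ofReal_ne_top fun w => ?_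
    by_cases hw : w ∈ K
    · rw [indicator_of_mem (hKQ₂ hw)]
      exact hle w
    · rw [hD0 w hw, enorm_zero]
      exact zero_le
  have SUPP : ∀ (D : ℝ × EuclideanSpace ℝ (Fin 3) → ℝ), (∀ w, w ∉ K → D w = 0) →
      support (fun w => ‖D w‖ₑ) ⊆ FluidPDE.parabolicCylinderCentered r₂ z₀ := by
    intro D hD0 w hw
    by_contra h
    exact hw (by simp [hD0 w (fun hK' => h (hKQ₂ hK'))])
  have EQZ : ∀ (D : ℝ × EuclideanSpace ℝ (Fin 3) → ℝ), (∀ w, w ∉ K → D w = 0) →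
      ∀ w : ℝ × EuclideanSpace ℝ (Fin 3), w.1 ≤ T → D w = 0 := fun D hD0 w hw => hD0 w (hKT w hw)
  -- measurability of the basic monomials
  have meu : ∀ a : EuclideanSpace ℝ (Fin 3), Measurable fun z : ℝ × EuclideanSpace ℝ (Fin 3) => (⟪ut z, a⟫ : ℝ) :=
    fun a => hutm.inner measurable_const
  have cφ : Continuous fun z : ℝ × EuclideanSpace ℝ (Fin 3) => φ z.1 z.2 := hφT.contDiff.continuous
  have cφt : Continuous fun z : ℝ × EuclideanSpace ℝ (Fin 3) => timeDeriv φ z.1 z.2 :=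
    hφT.continuous_timeDeriv
  have cφΔ : Continuous fun z : ℝ × EuclideanSpace ℝ (Fin 3) => (Δ (φ z.1)) z.2 := by
    have h := (((hφT.mono le_top).isSmoothSpaceTimeOn univ).laplacian uniqueDiffOn_univ).continuousOn
    rw [univ_prod_univ, continuousOn_univ] at h
    exact h
  have cφi : ∀ v : EuclideanSpace ℝ (Fin 3),
      Continuous fun z : ℝ × EuclideanSpace ℝ (Fin 3) => fderiv ℝ (φ z.1) z.2 v := fun v =>
    continuous_fderiv_slice_of_contDiff hφT.contDiff v
  /- ### the heat data `H1`, `H3 i`, `H6` and the multiplier data `M2 i`, `M4 i`, `M10 i j` -/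
  set H1 : ℝ × EuclideanSpace ℝ (Fin 3) → ℝ := fun z =>
    (timeDeriv φ z.1 z.2 + ν * (Δ (φ z.1)) z.2) * ⟪ut z, c⟫ with hH1
  set H3 : Fin 3 → ℝ × EuclideanSpace ℝ (Fin 3) → ℝ := fun i z =>
    fderiv ℝ (φ z.1) z.2 (b i) * (⟪ut z, b i⟫ * ⟪ut z, c⟫) with hH3
  set H6 : ℝ × EuclideanSpace ℝ (Fin 3) → ℝ := fun z => φ z.1 z.2 * ⟪ft z, c⟫ with hH6
  set M2 : Fin 3 → ℝ × EuclideanSpace ℝ (Fin 3) → ℝ := fun i z =>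
    -((2 * ν * fderiv ℝ (φ z.1) z.2 (b i)) * ⟪ut z, c⟫) with hM2
  set M4 : Fin 3 → ℝ × EuclideanSpace ℝ (Fin 3) → ℝ := fun i z =>
    -(φ z.1 z.2 * (⟪ut z, b i⟫ * ⟪ut z, c⟫)) with hM4
  set M10 : Fin 3 → Fin 3 → ℝ × EuclideanSpace ℝ (Fin 3) → ℝ := fun i j z =>
    -((-(φ z.1 z.2)) * (⟪ut z, b i⟫ * ⟪ut z, b j⟫)) with hM10
  have zH1 : ∀ w, w ∉ K → H1 w = 0 := fun w hw => by simp only [hH1]; rw [zφt w hw, zero_mul]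
  have zH3 : ∀ i w, w ∉ K → H3 i w = 0 := fun i w hw => by simp only [hH3]; rw [zφi (b i) w hw, zero_mul]
  have zH6 : ∀ w, w ∉ K → H6 w = 0 := fun w hw => by simp only [hH6]; rw [zφ w hw, zero_mul]
  have zM2 : ∀ i w, w ∉ K → M2 i w = 0 := fun i w hw => by
    simp only [hM2]; rw [zφi (b i) w hw, mul_zero, zero_mul, neg_zero]
  have zM4 : ∀ i w, w ∉ K → M4 i w = 0 := fun i w hw => by simp only [hM4]; rw [zφ w hw, zero_mul, neg_zero]
  have zM10 : ∀ i j w, w ∉ K → M10 i j w = 0 := fun i j w hw => by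
    simp only [hM10]; rw [zφ w hw, neg_zero, zero_mul, neg_zero]
  have mH1 : Measurable H1 := (cφt.add (continuous_const.mul cφΔ)).measurable.mul (meu c)
  have mH3 : ∀ i, Measurable (H3 i) := fun i => (cφi (b i)).measurable.mul ((meu (b i)).mul (meu c))
  have mH6 : Measurable H6 := cφ.measurable.mul (hftm.inner measurable_const)
  have mM2 : ∀ i, Measurable (M2 i) := fun i =>
    ((continuous_const.mul (cφi (b i))).measurable.mul (meu c)).neg
  have mM4 : ∀ i, Measurable (M4 i) := fun i => (cφ.measurable.mul ((meu (b i)).mul (meu c))).neg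
  have mM10 : ∀ i j, Measurable (M10 i j) := fun i j =>
    (cφ.measurable.neg.mul ((meu (b i)).mul (meu (b j)))).neg
  -- pointwise bounds
  have bH1 : ∀ w, ‖H1 w‖ₑ ≤ ENNReal.ofReal (Mt + ν * MΔ) * ‖ut w‖ₑ := fun w => by
    simp only [hH1]; rw [enorm_mul]
    exact mul_le_mul' (eT1 w) (enorm_inner_le_enorm_of_norm_le_one _ hc1)
  have bH3 : ∀ i w, ‖H3 i w‖ₑ ≤ ENNReal.ofReal (M1 i) * (‖ut w‖ₑ * ‖ut w‖ₑ) := fun i w => by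
    simp only [hH3]; rw [enorm_mul]
    exact mul_le_mul' (eT3 i w) (enorm_inner_mul_inner_le _ (hb1 i) hc1)
  have bH6 : ∀ w, ‖H6 w‖ₑ ≤ ENNReal.ofReal 1 * ‖ft w‖ₑ := fun w => by
    simp only [hH6]; rw [enorm_mul]
    exact mul_le_mul' (eφ w) (enorm_inner_le_enorm_of_norm_le_one _ hc1)
  have bM2 : ∀ i w, ‖M2 i w‖ₑ ≤ ENNReal.ofReal (2 * ν * M1 i) * ‖ut w‖ₑ := fun i w => by
    simp only [hM2]; rw [enorm_neg, enorm_mul]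
    refine mul_le_mul' ?_ (enorm_inner_le_enorm_of_norm_le_one _ hc1)
    have := eT2 i w
    rwa [enorm_neg] at this
  have bM4 : ∀ i w, ‖M4 i w‖ₑ ≤ ENNReal.ofReal 1 * (‖ut w‖ₑ * ‖ut w‖ₑ) := fun i w => by
    simp only [hM4]; rw [enorm_neg, enorm_mul]
    exact mul_le_mul' (eφ w) (enorm_inner_mul_inner_le _ (hb1 i) hc1)
  have bM10 : ∀ i j w, ‖M10 i j w‖ₑ ≤ ENNReal.ofReal 1 * (‖ut w‖ₑ * ‖ut w‖ₑ) := fun i j w => by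
    simp only [hM10]; rw [enorm_neg, enorm_mul]
    exact mul_le_mul' (eφ' w) (enorm_inner_mul_inner_le _ (hb1 i) (hb1 j))
  -- the classes
  have hτ₀4 : 5 / 2 < min τ₀ 4 := lt_min hτ₀ (by norm_num)
  have cls1 : IsHeatDatum T 3 4 H1 :=
    ⟨by norm_num, by norm_num, by norm_num, by norm_num, mH1, EQZ H1 zH1,
      (CLS H1 _ 3 τ₂ _ morU (by norm_num) bH1 zH1).of_exponent_le_of_support (SUPP H1 zH1) hr₂
        (by norm_num) (by norm_num) (by linarith)⟩
  have cls3 : ∀ i, IsHeatDatum T (3 / 2) 4 (H3 i) := fun i =>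
    ⟨by norm_num, by norm_num, by norm_num, by norm_num, mH3 i, EQZ (H3 i) (zH3 i),
      (CLS (H3 i) _ (3 / 2) ρ' _ morUU (by norm_num) (bH3 i) (zH3 i)).of_exponent_le_of_support
        (SUPP (H3 i) (zH3 i)) hr₂ (by norm_num) (by norm_num) (by linarith)⟩
  have cls6 : IsHeatDatum T (10 / 7) (min τ₀ 4) H6 :=
    ⟨by norm_num, le_min (by linarith) (by norm_num), hτ₀4, (min_le_right _ _).trans_lt (by norm_num), mH6,
      EQZ H6 zH6,
      (CLS H6 _ (10 / 7) τ₀ _ morF (by norm_num) bH6 zH6).of_exponent_le_of_support (SUPP H6 zH6) hr₂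
        (by norm_num) (le_min (by linarith) (by norm_num)) (min_le_left _ _)⟩
  have hp2 : (5 : ℝ) / 2 ≤ 5 * τ₂ / (τ₂ + 5) := by
    rw [div_le_div_iff₀ (by norm_num) (by linarith)]; nlinarith
  have hp4 : (3 : ℝ) / 2 ≤ 5 * ρ' / (ρ' + 5) := by
    rw [div_le_div_iff₀ (by norm_num) (by linarith)]; nlinarith
  have clsM2 : ∀ i, IsMultiplierDatum T (5 / 2) τ₂ (derivSymbol (b i)) (M2 i) := fun i =>
    ⟨by norm_num, hp2, hτ₂, contDiffOn_derivSymbol (b i), fun t ht ξ => derivSymbol_smul (b i) t ht ξ, mM2 i,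
      EQZ (M2 i) (zM2 i),
      (CLS (M2 i) _ 3 τ₂ _ morU (by norm_num) (bM2 i) (zM2 i)).of_integrability_le (mM2 i).enorm.aemeasurable
        (by norm_num) (by norm_num)⟩
  have clsM4 : ∀ i, IsMultiplierDatum T (3 / 2) ρ' (derivSymbol (b i)) (M4 i) := fun i =>
    ⟨by norm_num, hp4, hρ'5, contDiffOn_derivSymbol (b i), fun t ht ξ => derivSymbol_smul (b i) t ht ξ, mM4 i,
      EQZ (M4 i) (zM4 i), CLS (M4 i) _ (3 / 2) ρ' _ morUU (by norm_num) (bM4 i) (zM4 i)⟩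
  have clsM10 : ∀ i j, IsMultiplierDatum T (3 / 2) ρ' (oseenSymbol (b j) (b i) c) (M10 i j) := fun i j =>
    ⟨by norm_num, hp4, hρ'5, contDiffOn_oseenSymbol (b j) (b i) c,
      fun t ht ξ => oseenSymbol_smul (b j) (b i) c t ht ξ, mM10 i j,
      EQZ (M10 i j) (zM10 i j), CLS (M10 i j) _ (3 / 2) ρ' _ morUU (by norm_num) (bM10 i j) (zM10 i j)⟩
  /- ### integrability of the localised data -/
  have mu' : ∀ a : EuclideanSpace ℝ (Fin 3),
      IntegrableOn (fun z : ℝ × EuclideanSpace ℝ (Fin 3) => (⟪ut z, a⟫ : ℝ)) K volume := fun a =>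
    (integrableOn_inner_of_locallyIntegrableOn hKc hKΩ hu a).congr_fun_ae
      (by filter_upwards [aeK hut] with z hz; rw [hz])
  have muu' : ∀ a a' : EuclideanSpace ℝ (Fin 3), IntegrableOn
      (fun z : ℝ × EuclideanSpace ℝ (Fin 3) => (⟪ut z, a⟫ : ℝ) * ⟪ut z, a'⟫) K volume := fun a a' =>
    (integrableOn_inner_mul_inner_of_locallyIntegrableOn hKc hKΩ hu hu2 a a').congr_fun_ae
      (by filter_upwards [aeK hut] with z hz; rw [hz])
  have mp' : IntegrableOn pt K volume :=
    (hp.integrableOn_compact_subset hKΩ hKc).congr_fun_ae (by filter_upwards [aeK hpt] with z hz; exact hz)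
  have mf0 : IntegrableOn (fun z : ℝ × EuclideanSpace ℝ (Fin 3) => (⟪f z.1 z.2, c⟫ : ℝ)) K volume :=
    (hfloc.integrableOn_compact_subset hKΩ hKc).inner_const c
  have mf' : IntegrableOn (fun z : ℝ × EuclideanSpace ℝ (Fin 3) => (⟪ft z, c⟫ : ℝ)) K volume :=
    mf0.congr_fun_ae (by filter_upwards [aeK hft] with z hz; rw [hz])
  have cT1 : Continuous (fun z : ℝ × EuclideanSpace ℝ (Fin 3) => timeDeriv φ z.1 z.2 + ν * (Δ (φ z.1)) z.2) :=
    cφt.add (continuous_const.mul cφΔ)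
  have cT2 : ∀ i, Continuous (fun z : ℝ × EuclideanSpace ℝ (Fin 3) => 2 * ν * fderiv ℝ (φ z.1) z.2 (b i)) :=
    fun i => continuous_const.mul (cφi (b i))
  have cT10 : Continuous (fun z : ℝ × EuclideanSpace ℝ (Fin 3) => -(φ z.1 z.2)) := cφ.neg
  have iH1 : Integrable H1 volume :=
    integrable_coeff_mul hKc (T := fun z => timeDeriv φ z.1 z.2 + ν * (Δ (φ z.1)) z.2)
      (m := fun z => ⟪ut z, c⟫) cT1 zφt (mu' c)
  have iH3 : ∀ i, Integrable (H3 i) volume := fun i =>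
    integrable_coeff_mul hKc (T := fun z => fderiv ℝ (φ z.1) z.2 (b i)) (m := fun z => ⟪ut z, b i⟫ * ⟪ut z, c⟫)
      (cφi (b i)) (zφi (b i)) (muu' (b i) c)
  have iH6 : Integrable H6 volume :=
    integrable_coeff_mul hKc (T := fun z => φ z.1 z.2) (m := fun z => ⟪ft z, c⟫) cφ zφ mf'
  have iM2 : ∀ i, Integrable (M2 i) volume := fun i =>
    (integrable_coeff_mul hKc (T := fun z => 2 * ν * fderiv ℝ (φ z.1) z.2 (b i)) (m := fun z => ⟪ut z, c⟫)
      (cT2 i)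
      (fun z hz => by show 2 * ν * fderiv ℝ (φ z.1) z.2 (b i) = 0; rw [zφi (b i) z hz, mul_zero]) (mu' c)).neg
  have iM4 : ∀ i, Integrable (M4 i) volume := fun i =>
    (integrable_coeff_mul hKc (T := fun z => φ z.1 z.2) (m := fun z => ⟪ut z, b i⟫ * ⟪ut z, c⟫) cφ zφ
      (muu' (b i) c)).neg
  set G10 : Fin 3 → Fin 3 → ℝ × EuclideanSpace ℝ (Fin 3) → ℝ := fun i j z =>
    (-(φ z.1 z.2)) * (⟪ut z, b i⟫ * ⟪ut z, b j⟫) with hG10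
  have zG10 : ∀ i j w, w ∉ K → G10 i j w = 0 := fun i j w hw => by
    simp only [hG10]; rw [zφ w hw, neg_zero, zero_mul]
  have mG10 : ∀ i j, Measurable (G10 i j) := fun i j => cφ.measurable.neg.mul ((meu (b i)).mul (meu (b j)))
  have iG10 : ∀ i j, Integrable (G10 i j) volume := fun i j =>
    integrable_coeff_mul hKc (T := fun z => -(φ z.1 z.2)) (m := fun z => ⟪ut z, b i⟫ * ⟪ut z, b j⟫) cT10
      (fun z hz => by show -(φ z.1 z.2) = 0; rw [zφ z hz, neg_zero]) (muu' (b i) (b j))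
  have hM10G : ∀ i j, M10 i j = fun z => -G10 i j z := fun i j => rfl
  have iM10 : ∀ i j, Integrable (M10 i j) volume := fun i j => by rw [hM10G]; exact (iG10 i j).neg
  set G7 : ℝ × EuclideanSpace ℝ (Fin 3) → ℝ := fun z => φ z.1 z.2 * pt z with hG7
  have zG7 : ∀ w, w ∉ K → G7 w = 0 := fun w hw => by simp only [hG7]; rw [zφ w hw, zero_mul]
  have mG7 : Measurable G7 := cφ.measurable.mul hptm
  have iG7 : Integrable G7 volume := integrable_coeff_mul hKc (T := fun z => φ z.1 z.2) (m := pt) cφ zφ mp'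
  /- ### the smeared data `H7` and `H10 i j` -/
  -- the profiles
  set μ7 : EuclideanSpace ℝ (Fin 3) → ℝ := fun y => fderiv ℝ (newtonFarLaplacian r₀ r₁) y c with hμ7
  obtain ⟨hμ7C, hμ7c⟩ := contDiff_hasCompactSupport_fderiv_apply (contDiff_newtonFarLaplacian h₀ h₁ (n := ⊤))
    (hasCompactSupport_newtonFarLaplacian h₀.le h₁) c
  obtain ⟨B7, hB7⟩ := hμ7c.exists_bound_of_continuous hμ7C.continuous
  have hμ7b : ∀ y, |μ7 y| ≤ B7 := fun y => by rw [← Real.norm_eq_abs]; exact hB7 y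
  have hμ7m : Measurable μ7 := hμ7C.continuous.measurable
  have hμ7i : Integrable μ7 volume := hμ7C.continuous.integrable_of_hasCompactSupport hμ7c
  set μ10 : Fin 3 → Fin 3 → EuclideanSpace ℝ (Fin 3) → ℝ := fun i j => newtonFarD3Profile r₀ r₁ (b j) (b i) c
    with hμ10
  have hμ10bex : ∀ i j, ∃ B : ℝ, ∀ y, |μ10 i j y| ≤ B := fun i j =>
    exists_abs_newtonFarD3Profile_le h₀ h₁ (b j) (b i) c
  choose B10 hB10 using hμ10bex
  have hμ10m : ∀ i j, Measurable (μ10 i j) := fun i j => measurable_newtonFarD3Profile h₀ h₁ (b j) (b i) c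
  have hμ10i : ∀ i j, Integrable (μ10 i j) volume := fun i j =>
    integrable_newtonFarD3Profile h₀ h₁ (hb1 j) (hb1 i) hc1
  -- the smeared data
  set H7 : ℝ × EuclideanSpace ℝ (Fin 3) → ℝ := fun q => ∫ y, μ7 (y - q.2) * G7 (q.1, y) with hH7
  set H10 : Fin 3 → Fin 3 → ℝ × EuclideanSpace ℝ (Fin 3) → ℝ := fun i j q =>
    ∫ y, μ10 i j (y - q.2) * G10 i j (q.1, y) with hH10
  have mH7 : Measurable H7 := (stronglyMeasurable_smearedData (E := EuclideanSpace ℝ (Fin 3)) hμ7m mG7).measurable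
  have mH10 : ∀ i j, Measurable (H10 i j) := fun i j =>
    (stronglyMeasurable_smearedData (E := EuclideanSpace ℝ (Fin 3)) (hμ10m i j) (mG10 i j)).measurable
  have iH7 : Integrable H7 volume := integrable_smearedData hμ7m hμ7i mG7 iG7
  have iH10 : ∀ i j, Integrable (H10 i j) volume := fun i j =>
    integrable_smearedData (hμ10m i j) (hμ10i i j) (mG10 i j) (iG10 i j)
  -- slices of the underlying data vanish outside the time support of `K`
  have sliceG7 : ∀ s : ℝ, s ∉ Icc (z₀.1 - ρ₂ ^ 2) (z₀.1 + ρ₂ ^ 2) → ∀ y, G7 (s, y) = 0 := fun s hs y =>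
    zG7 (s, y) (fun h => hs (hKt _ h))
  have sliceG10 : ∀ i j (s : ℝ), s ∉ Icc (z₀.1 - ρ₂ ^ 2) (z₀.1 + ρ₂ ^ 2) → ∀ y, G10 i j (s, y) = 0 :=
    fun i j s hs y => zG10 i j (s, y) (fun h => hs (hKt _ h))
  have zH7T : ∀ w : ℝ × EuclideanSpace ℝ (Fin 3), w.1 ≤ T → H7 w = 0 := by
    intro w hw
    simp only [hH7]
    refine smearedData_eq_zero_of_slice (fun y => zG7 (w.1, y) (hKT _ hw)) w.2
  have zH10T : ∀ i j (w : ℝ × EuclideanSpace ℝ (Fin 3)), w.1 ≤ T → H10 i j w = 0 := by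
    intro i j w hw
    simp only [hH10]
    refine smearedData_eq_zero_of_slice (fun y => zG10 i j (w.1, y) (hKT _ hw)) w.2
  have sH7 : ∀ᵐ z ∂(volume : Measure (ℝ × EuclideanSpace ℝ (Fin 3))), H7 z ≠ 0 →
      z.1 ∈ Icc (z₀.1 - ρ₂ ^ 2) (z₀.1 + ρ₂ ^ 2) := Eventually.of_forall fun z hz => by
    by_contra h
    exact hz (by simp only [hH7]; exact smearedData_eq_zero_of_slice (sliceG7 z.1 h) z.2)
  have sH10 : ∀ i j, ∀ᵐ z ∂(volume : Measure (ℝ × EuclideanSpace ℝ (Fin 3))), H10 i j z ≠ 0 →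
      z.1 ∈ Icc (z₀.1 - ρ₂ ^ 2) (z₀.1 + ρ₂ ^ 2) := fun i j => Eventually.of_forall fun z hz => by
    by_contra h
    exact hz (by simp only [hH10]; exact smearedData_eq_zero_of_slice (sliceG10 i j z.1 h) z.2)
  -- spatial support of the underlying data
  have xG7 : ∀ (s : ℝ) (y : EuclideanSpace ℝ (Fin 3)), y ∉ closedBall z₀.2 ρ₂ → G7 (s, y) = 0 :=
    fun s y hy => zG7 (s, y) (fun h => hy (hKx (s, y) h))
  have xG10 : ∀ (i j : Fin 3) (s : ℝ) (y : EuclideanSpace ℝ (Fin 3)), y ∉ closedBall z₀.2 ρ₂ → G10 i j (s, y) = 0 :=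
    fun i j s y hy => zG10 i j (s, y) (fun h => hy (hKx (s, y) h))
  have hBfin : (volume : Measure (EuclideanSpace ℝ (Fin 3))) (closedBall z₀.2 ρ₂) ≠ ∞ :=
    (measure_closedBall_lt_top (μ := (volume : Measure (EuclideanSpace ℝ (Fin 3)))) (x := z₀.2) (r := ρ₂)).ne
  -- moments of the underlying data
  have hG7p : ∫⁻ z, ‖G7 z‖ₑ ^ q₀ < ∞ := by
    have h1 : ∫⁻ z, ‖G7 z‖ₑ ^ q₀ = ∫⁻ z in K, ‖G7 z‖ₑ ^ q₀ := by
      rw [← setLIntegral_univ]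
      rw [setLIntegral_eq_inter_of_eq_zero_off hKc.measurableSet (fun w hw => by
        rw [zG7 w hw, enorm_zero]) (zero_lt_one.trans hq₀) univ, univ_inter]
    rw [h1]
    refine lt_of_le_of_lt (lintegral_mono fun z => ?_) hPq
    refine ENNReal.rpow_le_rpow ?_ (zero_le_one.trans hq₀.le)
    simp only [hG7]
    rw [enorm_mul]
    calc ‖φ z.1 z.2‖ₑ * ‖pt z‖ₑ ≤ ENNReal.ofReal 1 * ‖pt z‖ₑ := mul_le_mul' (eφ z) le_rfl
      _ = ‖pt z‖ₑ := by rw [ENNReal.ofReal_one, one_mul]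
  have hG10p : ∀ i j, ∫⁻ z, ‖G10 i j z‖ₑ ^ (3 / 2 : ℝ) < ∞ := by
    intro i j
    have h1 : ∫⁻ z, ‖G10 i j z‖ₑ ^ (3 / 2 : ℝ) = ∫⁻ z in K, ‖G10 i j z‖ₑ ^ (3 / 2 : ℝ) := by
      rw [← setLIntegral_univ]
      rw [setLIntegral_eq_inter_of_eq_zero_off hKc.measurableSet (fun w hw => by
        rw [zG10 i j w hw, enorm_zero]) (by norm_num) univ, univ_inter]
    rw [h1]
    have h2 : ∫⁻ z in K, ‖G10 i j z‖ₑ ^ (3 / 2 : ℝ) ≤ ∫⁻ z in K, ‖ut z‖ₑ ^ (3 : ℝ) := by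
      refine lintegral_mono fun z => ?_
      have hb := (show ‖G10 i j z‖ₑ ≤ ENNReal.ofReal 1 * (‖ut z‖ₑ * ‖ut z‖ₑ) by
        simp only [hG10]; rw [enorm_mul]
        exact mul_le_mul' (eφ' z) (enorm_inner_mul_inner_le _ (hb1 i) (hb1 j)))
      rw [ENNReal.ofReal_one, one_mul] at hb
      calc ‖G10 i j z‖ₑ ^ (3 / 2 : ℝ) ≤ (‖ut z‖ₑ * ‖ut z‖ₑ) ^ (3 / 2 : ℝ) := ENNReal.rpow_le_rpow hb (by norm_num)
        _ = ‖ut z‖ₑ ^ (3 : ℝ) := by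
            rw [← sq, ← ENNReal.rpow_natCast, ← ENNReal.rpow_mul]
            norm_num
    exact h2.trans_lt ((lintegral_mono_set hKQ₂).trans_lt hU3)
  -- the classes of the smeared data
  have cls7 : IsHeatDatum T q₀ (5 * q₀ / 2) H7 :=
    ⟨hq₀.le, by linarith only [hq₀], by linarith only [hq₀], by linarith only [hq₀'], mH7, zH7T,
      isParabolicMorreyOn_smearedData hμ7b mG7 measurableSet_closedBall hBfin xG7 hq₀ hG7p⟩
  have cls10 : ∀ i j, IsHeatDatum T (3 / 2) (5 * (3 / 2) / 2) (H10 i j) := fun i j =>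
    ⟨by norm_num, by norm_num, by norm_num, by norm_num, mH10 i j, zH10T i j,
      isParabolicMorreyOn_smearedData (hB10 i j) (mG10 i j) measurableSet_closedBall hBfin (xG10 i j)
        (by norm_num) (hG10p i j)⟩
  /- ### the far-field terms: data, kernels, smoothness near `Q̄₃`, parabolic Lipschitz bound -/
  -- annulus data
  set G5 : ℝ × EuclideanSpace ℝ (Fin 3) → ℝ := fun z => fderiv ℝ (φ z.1) z.2 c * pt z with hG5
  set G8 : ℝ × EuclideanSpace ℝ (Fin 3) → ℝ := fun z => (-(Δ (φ z.1)) z.2) * pt z with hG8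
  set G9 : Fin 3 → ℝ × EuclideanSpace ℝ (Fin 3) → ℝ := fun i z =>
    (-(2 * fderiv ℝ (φ z.1) z.2 (b i))) * pt z with hG9
  set G11 : Fin 3 → Fin 3 → ℝ × EuclideanSpace ℝ (Fin 3) → ℝ := fun i j z =>
    (-(fderiv ℝ (fun y => fderiv ℝ (φ z.1) y (b i)) z.2 (b j))) * (⟪ut z, b i⟫ * ⟪ut z, b j⟫) with hG11
  set G12 : Fin 3 → Fin 3 → ℝ × EuclideanSpace ℝ (Fin 3) → ℝ := fun i j z =>
    (-(2 * fderiv ℝ (φ z.1) z.2 (b j))) * (⟪ut z, b j⟫ * ⟪ut z, b i⟫) with hG12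
  have cφij : ∀ v w : EuclideanSpace ℝ (Fin 3), Continuous fun z : ℝ × EuclideanSpace ℝ (Fin 3) =>
      fderiv ℝ (fun y => fderiv ℝ (φ z.1) y v) z.2 w :=
    fun v w => hφT.continuous_fderiv_fderiv_slice v w
  have zφij : ∀ (v w : EuclideanSpace ℝ (Fin 3)) (z : ℝ × EuclideanSpace ℝ (Fin 3)), z ∉ K →
      fderiv ℝ (fun y => fderiv ℝ (φ z.1) y v) z.2 w = 0 := fun v w z hz =>
    fderiv_fderiv_slice_eq_zero_of_notMem_tsupport hz v w
  have cT5 : Continuous (fun z : ℝ × EuclideanSpace ℝ (Fin 3) => fderiv ℝ (φ z.1) z.2 c) := cφi c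
  have cT8 : Continuous (fun z : ℝ × EuclideanSpace ℝ (Fin 3) => -(Δ (φ z.1)) z.2) := cφΔ.neg
  have cT9' : ∀ i, Continuous (fun z : ℝ × EuclideanSpace ℝ (Fin 3) => 2 * fderiv ℝ (φ z.1) z.2 (b i)) :=
    fun i => continuous_const.mul (cφi (b i))
  have cT9 : ∀ i, Continuous (fun z : ℝ × EuclideanSpace ℝ (Fin 3) => -(2 * fderiv ℝ (φ z.1) z.2 (b i))) :=
    fun i => (cT9' i).neg
  have cT11 : ∀ i j, Continuous (fun z : ℝ × EuclideanSpace ℝ (Fin 3) =>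
      -(fderiv ℝ (fun y => fderiv ℝ (φ z.1) y (b i)) z.2 (b j))) := fun i j => (cφij (b i) (b j)).neg
  have iG5 : Integrable G5 volume :=
    integrable_coeff_mul hKc (T := fun z => fderiv ℝ (φ z.1) z.2 c) (m := pt) cT5 (zφi c) mp'
  have iG8 : Integrable G8 volume :=
    integrable_coeff_mul hKc (T := fun z => -(Δ (φ z.1)) z.2) (m := pt) cT8
      (fun z hz => by show -(Δ (φ z.1)) z.2 = 0; rw [laplacian_slice_eq_zero_of_notMem_tsupport hz, neg_zero]) mp'
  have iG9 : ∀ i, Integrable (G9 i) volume := fun i =>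
    integrable_coeff_mul hKc (T := fun z => -(2 * fderiv ℝ (φ z.1) z.2 (b i))) (m := pt) (cT9 i)
      (fun z hz => by show -(2 * fderiv ℝ (φ z.1) z.2 (b i)) = 0; rw [zφi (b i) z hz, mul_zero, neg_zero]) mp'
  have iG11 : ∀ i j, Integrable (G11 i j) volume := fun i j =>
    integrable_coeff_mul hKc (T := fun z => -(fderiv ℝ (fun y => fderiv ℝ (φ z.1) y (b i)) z.2 (b j)))
      (m := fun z => ⟪ut z, b i⟫ * ⟪ut z, b j⟫) (cT11 i j)
      (fun z hz => by
        show -(fderiv ℝ (fun y => fderiv ℝ (φ z.1) y (b i)) z.2 (b j)) = 0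
        rw [zφij (b i) (b j) z hz, neg_zero]) (muu' (b i) (b j))
  have iG12 : ∀ i j, Integrable (G12 i j) volume := fun i j =>
    integrable_coeff_mul hKc (T := fun z => -(2 * fderiv ℝ (φ z.1) z.2 (b j)))
      (m := fun z => ⟪ut z, b j⟫ * ⟪ut z, b i⟫) (cT9 j)
      (fun z hz => by show -(2 * fderiv ℝ (φ z.1) z.2 (b j)) = 0; rw [zφi (b j) z hz, mul_zero, neg_zero])
      (muu' (b j) (b i))
  -- the annulus `A` and vanishing of the annulus data off `A`
  set A : Set (ℝ × EuclideanSpace ℝ (Fin 3)) :=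
    Icc (z₀.1 - ρ₂ ^ 2) (z₀.1 + ρ₂ ^ 2) ×ˢ (closedBall z₀.2 ρ₂ ∩ {y | ρ₁ ≤ dist y z₀.2}) with hA_def
  have hAc : IsCompact A :=
    isCompact_Icc.prod ((isCompact_closedBall z₀.2 ρ₂).inter_right
      (isClosed_le continuous_const (continuous_id.dist continuous_const)))
  have offA : ∀ (D : ℝ × EuclideanSpace ℝ (Fin 3) → ℝ), (∀ z, z ∉ K → D z = 0) →
      (∀ z : ℝ × EuclideanSpace ℝ (Fin 3), dist z.2 z₀.2 < ρ₁ → D z = 0) →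
      ∀ᵐ z ∂(volume : Measure (ℝ × EuclideanSpace ℝ (Fin 3))), z ∉ A → D z = 0 := by
    intro D hDK hDin
    refine Eventually.of_forall fun z hz => ?_
    by_cases hzK : z ∈ K
    · by_cases hin : dist z.2 z₀.2 < ρ₁
      · exact hDin z hin
      · exfalso
        refine hz ⟨hKt z hzK, hKx z hzK, ?_⟩
        rw [mem_setOf_eq]
        exact not_lt.1 hin
    · exact hDK z hzK
  have aG5 : ∀ᵐ z ∂(volume : Measure (ℝ × EuclideanSpace ℝ (Fin 3))), z ∉ A → G5 z = 0 :=
    offA G5 (fun z hz => by show fderiv ℝ (φ z.1) z.2 c * pt z = 0; rw [zφi c z hz, zero_mul])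
      (fun z hz => by show fderiv ℝ (φ z.1) z.2 c * pt z = 0; rw [(hflat z.1 z.2 hz).1]; simp)
  have aG8 : ∀ᵐ z ∂(volume : Measure (ℝ × EuclideanSpace ℝ (Fin 3))), z ∉ A → G8 z = 0 :=
    offA G8 (fun z hz => by
        show (-(Δ (φ z.1)) z.2) * pt z = 0
        rw [laplacian_slice_eq_zero_of_notMem_tsupport hz, neg_zero, zero_mul])
      (fun z hz => by show (-(Δ (φ z.1)) z.2) * pt z = 0; rw [(hflat z.1 z.2 hz).2.1, neg_zero, zero_mul])
  have aG9 : ∀ i, ∀ᵐ z ∂(volume : Measure (ℝ × EuclideanSpace ℝ (Fin 3))), z ∉ A → G9 i z = 0 := fun i =>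
    offA (G9 i) (fun z hz => by
        show (-(2 * fderiv ℝ (φ z.1) z.2 (b i))) * pt z = 0
        rw [zφi (b i) z hz, mul_zero, neg_zero, zero_mul])
      (fun z hz => by
        show (-(2 * fderiv ℝ (φ z.1) z.2 (b i))) * pt z = 0
        rw [(hflat z.1 z.2 hz).1]; simp)
  have aG11 : ∀ i j, ∀ᵐ z ∂(volume : Measure (ℝ × EuclideanSpace ℝ (Fin 3))), z ∉ A → G11 i j z = 0 :=
    fun i j => offA (G11 i j) (fun z hz => by
        show (-(fderiv ℝ (fun y => fderiv ℝ (φ z.1) y (b i)) z.2 (b j))) * (⟪ut z, b i⟫ * ⟪ut z, b j⟫) = 0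
        rw [zφij (b i) (b j) z hz, neg_zero, zero_mul])
      (fun z hz => by
        show (-(fderiv ℝ (fun y => fderiv ℝ (φ z.1) y (b i)) z.2 (b j))) * (⟪ut z, b i⟫ * ⟪ut z, b j⟫) = 0
        rw [(hflat z.1 z.2 hz).2.2 (b i) (b j), neg_zero, zero_mul])
  have aG12 : ∀ i j, ∀ᵐ z ∂(volume : Measure (ℝ × EuclideanSpace ℝ (Fin 3))), z ∉ A → G12 i j z = 0 :=
    fun i j => offA (G12 i j) (fun z hz => by
        show (-(2 * fderiv ℝ (φ z.1) z.2 (b j))) * (⟪ut z, b j⟫ * ⟪ut z, b i⟫) = 0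
        rw [zφi (b j) z hz, mul_zero, neg_zero, zero_mul])
      (fun z hz => by
        show (-(2 * fderiv ℝ (φ z.1) z.2 (b j))) * (⟪ut z, b j⟫ * ⟪ut z, b i⟫) = 0
        rw [(hflat z.1 z.2 hz).1]; simp)
  -- the neighbourhood `U` of `Q̄₃` and its separation from `A`
  set rU : ℝ := (r₃ + ρ₁) / 2 with hrU_def
  have hrU0 : 0 < rU := by rw [hrU_def]; linarith only [hr₃, hρ₁0]
  have hrU3 : r₃ < rU := by rw [hrU_def]; linarith only [hρ₁]
  set U : Set (ℝ × EuclideanSpace ℝ (Fin 3)) := Ioo (z₀.1 - 4 * r₂ ^ 2) (z₀.1 + 4 * r₂ ^ 2) ×ˢ ball z₀.2 rU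
    with hU_def
  have hUo : IsOpen U := isOpen_Ioo.prod isOpen_ball
  have hUb : Bornology.IsBounded U := (isBounded_Ioo _ _).prod isBounded_ball
  have hQ₃U : Q₃ ⊆ U := by
    intro z hz
    rw [hQ₃_def, FluidPDE.mem_parabolicCylinderCentered] at hz
    have hsq : r₃ ^ 2 < 4 * r₂ ^ 2 := by nlinarith
    refine ⟨⟨by linarith [hz.1.1], by linarith [hz.1.2]⟩, ?_⟩
    rw [mem_ball]
    exact hz.2.trans hrU3
  have hboxU : Icc (z₀.1 - r₃ ^ 2) (z₀.1 + r₃ ^ 2) ×ˢ closedBall z₀.2 r₃ ⊆ U := by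
    intro z hz
    have hsq : r₃ ^ 2 < 4 * r₂ ^ 2 := by nlinarith
    refine ⟨⟨by linarith [hz.1.1], by linarith [hz.1.2]⟩, ?_⟩
    rw [mem_ball]
    exact lt_of_le_of_lt (mem_closedBall.1 hz.2) hrU3
  have hclU : ∀ w ∈ closure U, dist w.2 z₀.2 ≤ rU := by
    intro w hw
    rw [hU_def, closure_prod_eq] at hw
    have h2 := hw.2
    rw [closure_ball z₀.2 hrU0.ne'] at h2
    exact mem_closedBall.1 h2
  have hsepA : ∀ w ∈ closure U, ∀ z ∈ A, δ / 2 ≤ ‖(w - z).2‖ := by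
    intro w hw z hz
    have h1 := hclU w hw
    have h2 : ρ₁ ≤ dist z.2 z₀.2 := hz.2.2
    rw [Prod.snd_sub]
    rw [dist_eq_norm] at h1 h2
    have h3 := norm_sub_le_norm_sub_add_norm_sub z.2 w.2 z₀.2
    rw [norm_sub_rev z.2 w.2] at h3
    have : δ / 2 = ρ₁ - rU := by rw [hδ_def, hrU_def]; ring
    rw [this]
    linarith
  -- the kernels are smooth on the separated region
  have hΓi : LocallyIntegrable (newtonNear r₀ r₁) volume :=
    (memLp_one_iff_integrable.1 (memLp_one_newtonNear h₀ h₁)).locallyIntegrable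
  have hΓsupp : ∀ y, newtonNear r₀ r₁ y ≠ 0 → ‖y‖ ≤ r₁ := newtonNear_ne_zero_norm_le h₀.le h₁
  have hε8 : 0 < δ / 8 := by positivity
  have hO₀ : IsOpen {q : ℝ × EuclideanSpace ℝ (Fin 3) | δ / 4 < ‖q.2‖} := isOpen_setOf_lt_norm_snd (δ / 4)
  have hO₁ : IsOpen {q : ℝ × EuclideanSpace ℝ (Fin 3) | r₁ + δ / 8 < ‖q.2‖} := isOpen_setOf_lt_norm_snd (r₁ + δ / 8)
  have sep₀ : ∀ w ∈ closure U, ∀ z ∈ A, w - z ∈ {q : ℝ × EuclideanSpace ℝ (Fin 3) | δ / 4 < ‖q.2‖} := by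
    intro w hw z hz
    have h := hsepA w hw z hz
    rw [mem_setOf_eq]
    linarith
  have sep₁ : ∀ w ∈ closure U, ∀ z ∈ A, w - z ∈ {q : ℝ × EuclideanSpace ℝ (Fin 3) | r₁ + δ / 8 < ‖q.2‖} := by
    intro w hw z hz
    have h := hsepA w hw z hz
    rw [mem_setOf_eq, hr₁_def]
    linarith
  have kH : ContDiffOn ℝ ((⊤ : ℕ∞) : WithTop ℕ∞)
      (fun q : ℝ × EuclideanSpace ℝ (Fin 3) =>
        backKernel (fun a y => UnboundedOperators.heatKernel (E := EuclideanSpace ℝ (Fin 3)) (ν * a) y) (-q))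
      {q : ℝ × EuclideanSpace ℝ (Fin 3) | δ / 4 < ‖q.2‖} :=
    contDiffOn_backKernel_heatKernel_reflect hν (by positivity)
  have kD1 : ContDiffOn ℝ ((⊤ : ℕ∞) : WithTop ℕ∞)
      (fun q : ℝ × EuclideanSpace ℝ (Fin 3) => backKernel (fun a y => heatD1 (ν * a) c (newtonNear r₀ r₁) y) (-q))
      {q : ℝ × EuclideanSpace ℝ (Fin 3) | r₁ + δ / 8 < ‖q.2‖} :=
    contDiffOn_backKernel_heatD1_reflect hΓi hΓsupp hν hε8 c
  have kD2 : ∀ i, ContDiffOn ℝ ((⊤ : ℕ∞) : WithTop ℕ∞)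
      (fun q : ℝ × EuclideanSpace ℝ (Fin 3) =>
        backKernel (fun a y => heatD2 (ν * a) (b i) c (newtonNear r₀ r₁) y) (-q))
      {q : ℝ × EuclideanSpace ℝ (Fin 3) | r₁ + δ / 8 < ‖q.2‖} := fun i =>
    contDiffOn_backKernel_heatD2_reflect hΓi hΓsupp hν hε8 (b i) c
  -- the far-field potentials
  set R5 : ℝ × EuclideanSpace ℝ (Fin 3) → ℝ := fun w => ∫ z, (fun v => backKernel
      (fun a y => UnboundedOperators.heatKernel (E := EuclideanSpace ℝ (Fin 3)) (ν * a) y) (-v)) (w - z) * G5 z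
    with hR5
  set R8 : ℝ × EuclideanSpace ℝ (Fin 3) → ℝ := fun w => ∫ z, (fun v => backKernel
      (fun a y => heatD1 (ν * a) c (newtonNear r₀ r₁) y) (-v)) (w - z) * G8 z with hR8
  set R9 : Fin 3 → ℝ × EuclideanSpace ℝ (Fin 3) → ℝ := fun i w => ∫ z, (fun v => backKernel
      (fun a y => heatD2 (ν * a) (b i) c (newtonNear r₀ r₁) y) (-v)) (w - z) * G9 i z with hR9
  set R11 : Fin 3 → Fin 3 → ℝ × EuclideanSpace ℝ (Fin 3) → ℝ := fun i j w => ∫ z, (fun v => backKernel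
      (fun a y => heatD1 (ν * a) c (newtonNear r₀ r₁) y) (-v)) (w - z) * G11 i j z with hR11
  set R12 : Fin 3 → Fin 3 → ℝ × EuclideanSpace ℝ (Fin 3) → ℝ := fun i j w => ∫ z, (fun v => backKernel
      (fun a y => heatD2 (ν * a) (b i) c (newtonNear r₀ r₁) y) (-v)) (w - z) * G12 i j z with hR12
  have sR5 : ContDiffOn ℝ ((⊤ : ℕ∞) : WithTop ℕ∞) R5 U :=
    contDiffOn_integral_kernel_of_separated hO₀ kH iG5 hAc aG5 hUb sep₀
  have sR8 : ContDiffOn ℝ ((⊤ : ℕ∞) : WithTop ℕ∞) R8 U :=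
    contDiffOn_integral_kernel_of_separated hO₁ kD1 iG8 hAc aG8 hUb sep₁
  have sR9 : ∀ i, ContDiffOn ℝ ((⊤ : ℕ∞) : WithTop ℕ∞) (R9 i) U := fun i =>
    contDiffOn_integral_kernel_of_separated hO₁ (kD2 i) (iG9 i) hAc (aG9 i) hUb sep₁
  have sR11 : ∀ i j, ContDiffOn ℝ ((⊤ : ℕ∞) : WithTop ℕ∞) (R11 i j) U := fun i j =>
    contDiffOn_integral_kernel_of_separated hO₁ kD1 (iG11 i j) hAc (aG11 i j) hUb sep₁
  have sR12 : ∀ i j, ContDiffOn ℝ ((⊤ : ℕ∞) : WithTop ℕ∞) (R12 i j) U := fun i j =>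
    contDiffOn_integral_kernel_of_separated hO₁ (kD2 i) (iG12 i j) hAc (aG12 i j) hUb sep₁
  set R : ℝ × EuclideanSpace ℝ (Fin 3) → ℝ := fun w =>
    R5 w + R8 w + ∑ i, R9 i w + ∑ i, ∑ j, R11 i j w + ∑ i, ∑ j, R12 i j w with hR_def
  have sR : ContDiffOn ℝ ((⊤ : ℕ∞) : WithTop ℕ∞) R U := by
    refine (((sR5.add sR8).add (ContDiffOn.sum fun i _ => sR9 i)).add
      (ContDiffOn.sum fun i _ => ContDiffOn.sum fun j _ => sR11 i j)).add
      (ContDiffOn.sum fun i _ => ContDiffOn.sum fun j _ => sR12 i j)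
  obtain ⟨Lip, hLip⟩ := parabolicHolderOnWith_one_of_contDiffOn hUo (sR.of_le (by exact_mod_cast le_top)) hr₃ hboxU
  /- ### the backward kernels and the local integrability of the forward potentials -/
  have hKh := (isSliceBoundKernel_backKernel_heatKernel (E := EuclideanSpace ℝ (Fin 3))).timeScale hν
  have hKgex : ∀ v : EuclideanSpace ℝ (Fin 3), ∃ N : ℝ → ℝ, IsSliceBoundKernel
      (backKernel fun a y => heatKernelGrad v (ν * a) y) N := fun v =>
    ⟨_, (isSliceBoundKernel_backKernel_heatKernelGrad (E := EuclideanSpace ℝ (Fin 3)) v).timeScale hν⟩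
  choose Ng hKg using hKgex
  have hK3ex : ∀ i j : Fin 3, ∃ N : ℝ → ℝ, IsSliceBoundKernel
      (backKernel fun a y => heatD3 (ν * a) (b j) (b i) c (newtonNear r₀ r₁) y) N := fun i j => by
    obtain ⟨C, -, hK⟩ := exists_isSliceBoundKernel_backKernel_heatD3_newtonNear h₀ h₁ (hb1 j) (hb1 i) hc1
    exact ⟨_, hK.timeScale hν⟩
  choose N3 hK3 using hK3ex
  -- time supports of the data
  have TS : ∀ (D : ℝ × EuclideanSpace ℝ (Fin 3) → ℝ), (∀ z, z ∉ K → D z = 0) →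
      ∀ᵐ z ∂(volume : Measure (ℝ × EuclideanSpace ℝ (Fin 3))), D z ≠ 0 → z.1 ∈ Icc (z₀.1 - ρ₂ ^ 2) (z₀.1 + ρ₂ ^ 2) :=
    fun D hD => Eventually.of_forall fun z hz => hKt z (by by_contra h; exact hz (hD z h))
  -- the data of the gradient terms, in the sign of the duality identity
  set F2 : Fin 3 → ℝ × EuclideanSpace ℝ (Fin 3) → ℝ := fun i z =>
    (2 * ν * fderiv ℝ (φ z.1) z.2 (b i)) * ⟪ut z, c⟫ with hF2
  set F4 : Fin 3 → ℝ × EuclideanSpace ℝ (Fin 3) → ℝ := fun i z => φ z.1 z.2 * (⟪ut z, b i⟫ * ⟪ut z, c⟫) with hF4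
  have hM2F : ∀ i, M2 i = fun z => -F2 i z := fun i => rfl
  have hM4F : ∀ i, M4 i = fun z => -F4 i z := fun i => rfl
  have iF2 : ∀ i, Integrable (F2 i) volume := fun i => by simpa [hM2F] using (iM2 i).neg
  have iF4 : ∀ i, Integrable (F4 i) volume := fun i => by simpa [hM4F] using (iM4 i).neg
  have zF2 : ∀ i z, z ∉ K → F2 i z = 0 := fun i z hz => by
    have := zM2 i z hz; rw [hM2F] at this; simpa using this
  have zF4 : ∀ i z, z ∉ K → F4 i z = 0 := fun i z hz => by
    have := zM4 i z hz; rw [hM4F] at this; simpa using this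
  -- local integrability of heat potentials and gradient multiplier potentials of localised data
  have LIh : ∀ (D : ℝ × EuclideanSpace ℝ (Fin 3) → ℝ), Integrable D volume → (∀ z, z ∉ K → D z = 0) →
      LocallyIntegrable (fun w => heatPotential ν D w) volume := by
    intro D hD hD0
    have h : LocallyIntegrable (fun w => ((fun v => backKernel
        (fun a y => UnboundedOperators.heatKernel (E := EuclideanSpace ℝ (Fin 3)) (ν * a) y) (-v))
        ⋆[lsmul ℝ ℝ, (volume : Measure (ℝ × EuclideanSpace ℝ (Fin 3)))] D) w) volume :=
      hKh.locallyIntegrable_convolution_reflect hD (TS D hD0)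
    simp only [convolution_reflect_backKernel_heatKernel] at h
    exact h
  have LIh' : ∀ (D : ℝ × EuclideanSpace ℝ (Fin 3) → ℝ), Integrable D volume →
      (∀ᵐ z ∂(volume : Measure (ℝ × EuclideanSpace ℝ (Fin 3))), D z ≠ 0 → z.1 ∈ Icc (z₀.1 - ρ₂ ^ 2) (z₀.1 + ρ₂ ^ 2)) →
      LocallyIntegrable (fun w => heatPotential ν D w) volume := by
    intro D hD hDs
    have h : LocallyIntegrable (fun w => ((fun v => backKernel
        (fun a y => UnboundedOperators.heatKernel (E := EuclideanSpace ℝ (Fin 3)) (ν * a) y) (-v))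
        ⋆[lsmul ℝ ℝ, (volume : Measure (ℝ × EuclideanSpace ℝ (Fin 3)))] D) w) volume :=
      hKh.locallyIntegrable_convolution_reflect hD hDs
    simp only [convolution_reflect_backKernel_heatKernel] at h
    exact h
  have LIg : ∀ (v : EuclideanSpace ℝ (Fin 3)) (D : ℝ × EuclideanSpace ℝ (Fin 3) → ℝ), Integrable D volume →
      (∀ z, z ∉ K → D z = 0) →
      LocallyIntegrable (fun w => -(multiplierHeatPotential ν (derivSymbol v) D w).re) volume := by
    intro v D hD hD0
    have h : LocallyIntegrable (fun w => ((fun q => backKernel (fun a y => heatKernelGrad v (ν * a) y) (-q))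
        ⋆[lsmul ℝ ℝ, (volume : Measure (ℝ × EuclideanSpace ℝ (Fin 3)))] D) w) volume :=
      (hKg v).locallyIntegrable_convolution_reflect hD (TS D hD0)
    simp only [convolution_reflect_backKernel_heatKernelGrad hν] at h
    exact h
  -- the potentials
  set P1 : ℝ × EuclideanSpace ℝ (Fin 3) → ℝ := fun w => heatPotential ν H1 w with hP1
  set P2 : Fin 3 → ℝ × EuclideanSpace ℝ (Fin 3) → ℝ := fun i w =>
    -(multiplierHeatPotential ν (derivSymbol (b i)) (F2 i) w).re with hP2
  set P3 : Fin 3 → ℝ × EuclideanSpace ℝ (Fin 3) → ℝ := fun i w => heatPotential ν (H3 i) w with hP3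
  set P4 : Fin 3 → ℝ × EuclideanSpace ℝ (Fin 3) → ℝ := fun i w =>
    -(multiplierHeatPotential ν (derivSymbol (b i)) (F4 i) w).re with hP4
  set P6 : ℝ × EuclideanSpace ℝ (Fin 3) → ℝ := fun w => heatPotential ν H6 w with hP6
  set P7 : ℝ × EuclideanSpace ℝ (Fin 3) → ℝ := fun w => heatPotential ν H7 w with hP7
  set N10 : Fin 3 → Fin 3 → ℝ × EuclideanSpace ℝ (Fin 3) → ℝ := fun i j w =>
    ((fun q => backKernel (fun a y => heatD3 (ν * a) (b j) (b i) c (newtonNear r₀ r₁) y) (-q))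
      ⋆[lsmul ℝ ℝ, (volume : Measure (ℝ × EuclideanSpace ℝ (Fin 3)))] G10 i j) w with hN10
  have lP1 : LocallyIntegrable P1 volume := LIh H1 iH1 zH1
  have lP2 : ∀ i, LocallyIntegrable (P2 i) volume := fun i => LIg (b i) (F2 i) (iF2 i) (zF2 i)
  have lP3 : ∀ i, LocallyIntegrable (P3 i) volume := fun i => LIh (H3 i) (iH3 i) (zH3 i)
  have lP4 : ∀ i, LocallyIntegrable (P4 i) volume := fun i => LIg (b i) (F4 i) (iF4 i) (zF4 i)
  have lP6 : LocallyIntegrable P6 volume := LIh H6 iH6 zH6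
  have lP7 : LocallyIntegrable P7 volume := LIh' H7 iH7 sH7
  have lN10 : ∀ i j, LocallyIntegrable (N10 i j) volume := fun i j =>
    (hK3 i j).locallyIntegrable_convolution_reflect (iG10 i j) (TS (G10 i j) (zG10 i j))
  have lH10 : ∀ i j, LocallyIntegrable (fun w => heatPotential ν (H10 i j) w) volume := fun i j =>
    LIh' (H10 i j) (iH10 i j) (sH10 i j)
  -- the a.e. forward identification of the Calderón–Zygmund potential on the support of a test function
  have AE10 : ∀ {θ : ℝ → EuclideanSpace ℝ (Fin 3) → ℝ},
      IsSpaceTimeTestOn (⊤ : Opens (ℝ × EuclideanSpace ℝ (Fin 3))) θ → ∀ i j,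
      ∀ᵐ w ∂(volume : Measure (ℝ × EuclideanSpace ℝ (Fin 3))),
        θ w.1 w.2 * N10 i j w = θ w.1 w.2 *
          (-(multiplierHeatPotential ν (oseenSymbol (b j) (b i) c) (G10 i j) w).re +
            heatPotential ν (H10 i j) w) := by
    intro θ hg i j
    obtain ⟨M, hM0, hM⟩ := hg.exists_norm_le
    obtain ⟨a', b', hab'⟩ := hg.exists_time_support
    have hgi := hg.integrable_uncurry
    have hgM : ∀ᵐ w ∂(volume : Measure (ℝ × EuclideanSpace ℝ (Fin 3))), |uncurry θ w| ≤ M :=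
      Eventually.of_forall fun w => by rw [← Real.norm_eq_abs]; exact hM w.1 w.2
    have hgsupp : ∀ᵐ w ∂(volume : Measure (ℝ × EuclideanSpace ℝ (Fin 3))), uncurry θ w ≠ 0 → w.1 ∈ Icc a' b' :=
      Eventually.of_forall fun w hw => by
        by_contra h
        have h0 : θ w.1 = 0 := hab' w.1 h
        exact hw (by simp [uncurry, h0])
    have hpair := (hK3 i j).integrable_kernelPairing_swap (iG10 i j) (TS (G10 i j) (zG10 i j)) hgi hM0 hgM hgsupp
    filter_upwards [hpair.prod_left_ae] with w hw
    simp only [uncurry] at hw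
    by_cases hgw : θ w.1 w.2 = 0
    · simp [hgw]
    · have hw' : Integrable (fun z => backKernel
          (fun a y => heatD3 (ν * a) (b j) (b i) c (newtonNear r₀ r₁) y) (z - w) * G10 i j z) volume := by
        have h2 := hw.const_mul (θ w.1 w.2)⁻¹
        refine h2.congr (Eventually.of_forall fun z => ?_)
        show (θ w.1 w.2)⁻¹ * (G10 i j z * (backKernel _ (z - w) * θ w.1 w.2)) = _
        field_simp
      congr 1
      simp only [hN10, hH10]
      exact convolution_reflect_backKernel_heatD3_newtonNear h₀ h₁ hν (hb1 j) (hb1 i) hc1 (mG10 i j) (iG10 i j) w hw'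
  /- ### the tested identity with the locally integrable representative -/
  set Pnice : ℝ × EuclideanSpace ℝ (Fin 3) → ℝ := fun w =>
    P1 w + ∑ i, P2 i w + ∑ i, P3 i w + ∑ i, P4 i w + R5 w + P6 w + P7 w + R8 w + ∑ i, R9 i w
      + ∑ i, ∑ j, N10 i j w + ∑ i, ∑ j, R11 i j w + ∑ i, ∑ j, R12 i j w with hPnice
  have hQ₃Ω' : FluidPDE.parabolicCylinderCentered r₃ z₀ ⊆ (Ω : Set (ℝ × EuclideanSpace ℝ (Fin 3))) := hQ₃Ω
  have MAIN : ∀ θ : ℝ → EuclideanSpace ℝ (Fin 3) → ℝ,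
      IsSpaceTimeTestOn (FluidPDE.parabolicCylinderCenteredOpens r₃ z₀) θ →
      ∫ z : ℝ × EuclideanSpace ℝ (Fin 3), θ z.1 z.2 * ⟪ut z, c⟫ =
        ∫ w : ℝ × EuclideanSpace ℝ (Fin 3), θ w.1 w.2 * Pnice w := by
    intro θ hθ
    have hg : IsSpaceTimeTestOn (⊤ : Opens (ℝ × EuclideanSpace ℝ (Fin 3))) θ := hθ.mono le_top
    have hθU : tsupport (uncurry θ) ⊆ U := hθ.tsupport_subset.trans hQ₃U
    have hrep := duhamel_pairing_identity hns hν hfloc hdivf hφT hKΩ hKt hr₃ hρ₁ hQ₃Ω' hone hflat hutm hptm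
      hut hpt hft h₀ h₁ k hθ
    rw [hrep]
    -- integrability of every `θ ·` piece
    have I1 : Integrable (fun w : ℝ × EuclideanSpace ℝ (Fin 3) => θ w.1 w.2 * P1 w) volume := integrable_test_mul lP1 hg
    have I2 : ∀ i, Integrable (fun w : ℝ × EuclideanSpace ℝ (Fin 3) => θ w.1 w.2 * P2 i w) volume := fun i =>
      integrable_test_mul (lP2 i) hg
    have I3 : ∀ i, Integrable (fun w : ℝ × EuclideanSpace ℝ (Fin 3) => θ w.1 w.2 * P3 i w) volume := fun i =>
      integrable_test_mul (lP3 i) hg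
    have I4 : ∀ i, Integrable (fun w : ℝ × EuclideanSpace ℝ (Fin 3) => θ w.1 w.2 * P4 i w) volume := fun i =>
      integrable_test_mul (lP4 i) hg
    have I5 : Integrable (fun w : ℝ × EuclideanSpace ℝ (Fin 3) => θ w.1 w.2 * R5 w) volume :=
      integrable_test_mul_of_continuousOn sR5.continuousOn hg hθU
    have I6 : Integrable (fun w : ℝ × EuclideanSpace ℝ (Fin 3) => θ w.1 w.2 * P6 w) volume := integrable_test_mul lP6 hg
    have I7 : Integrable (fun w : ℝ × EuclideanSpace ℝ (Fin 3) => θ w.1 w.2 * P7 w) volume := integrable_test_mul lP7 hg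
    have I8 : Integrable (fun w : ℝ × EuclideanSpace ℝ (Fin 3) => θ w.1 w.2 * R8 w) volume :=
      integrable_test_mul_of_continuousOn sR8.continuousOn hg hθU
    have I9 : ∀ i, Integrable (fun w : ℝ × EuclideanSpace ℝ (Fin 3) => θ w.1 w.2 * R9 i w) volume := fun i =>
      integrable_test_mul_of_continuousOn (sR9 i).continuousOn hg hθU
    have I10 : ∀ i j, Integrable (fun w : ℝ × EuclideanSpace ℝ (Fin 3) => θ w.1 w.2 * N10 i j w) volume := fun i j =>
      integrable_test_mul (lN10 i j) hg
    have I11 : ∀ i j, Integrable (fun w : ℝ × EuclideanSpace ℝ (Fin 3) => θ w.1 w.2 * R11 i j w) volume := fun i j =>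
      integrable_test_mul_of_continuousOn (sR11 i j).continuousOn hg hθU
    have I12 : ∀ i j, Integrable (fun w : ℝ × EuclideanSpace ℝ (Fin 3) => θ w.1 w.2 * R12 i j w) volume := fun i j =>
      integrable_test_mul_of_continuousOn (sR12 i j).continuousOn hg hθU
    have I2s : Integrable (fun w : ℝ × EuclideanSpace ℝ (Fin 3) => ∑ i, θ w.1 w.2 * P2 i w) volume :=
      integrable_finsetSum _ fun i _ => I2 i
    have I3s : Integrable (fun w : ℝ × EuclideanSpace ℝ (Fin 3) => ∑ i, θ w.1 w.2 * P3 i w) volume :=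
      integrable_finsetSum _ fun i _ => I3 i
    have I4s : Integrable (fun w : ℝ × EuclideanSpace ℝ (Fin 3) => ∑ i, θ w.1 w.2 * P4 i w) volume :=
      integrable_finsetSum _ fun i _ => I4 i
    have I9s : Integrable (fun w : ℝ × EuclideanSpace ℝ (Fin 3) => ∑ i, θ w.1 w.2 * R9 i w) volume :=
      integrable_finsetSum _ fun i _ => I9 i
    have I10s : Integrable (fun w : ℝ × EuclideanSpace ℝ (Fin 3) => ∑ i, ∑ j, θ w.1 w.2 * N10 i j w) volume :=
      integrable_finsetSum _ fun i _ => integrable_finsetSum _ fun j _ => I10 i j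
    have I11s : Integrable (fun w : ℝ × EuclideanSpace ℝ (Fin 3) => ∑ i, ∑ j, θ w.1 w.2 * R11 i j w) volume :=
      integrable_finsetSum _ fun i _ => integrable_finsetSum _ fun j _ => I11 i j
    have I12s : Integrable (fun w : ℝ × EuclideanSpace ℝ (Fin 3) => ∑ i, ∑ j, θ w.1 w.2 * R12 i j w) volume :=
      integrable_finsetSum _ fun i _ => integrable_finsetSum _ fun j _ => I12 i j
    -- distribute `θ` and split the integral
    have hdist : ∀ w : ℝ × EuclideanSpace ℝ (Fin 3), θ w.1 w.2 * Pnice w =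
        θ w.1 w.2 * P1 w + ∑ i, θ w.1 w.2 * P2 i w + ∑ i, θ w.1 w.2 * P3 i w + ∑ i, θ w.1 w.2 * P4 i w
          + θ w.1 w.2 * R5 w + θ w.1 w.2 * P6 w + θ w.1 w.2 * P7 w + θ w.1 w.2 * R8 w
          + ∑ i, θ w.1 w.2 * R9 i w + ∑ i, ∑ j, θ w.1 w.2 * N10 i j w
          + ∑ i, ∑ j, θ w.1 w.2 * R11 i j w + ∑ i, ∑ j, θ w.1 w.2 * R12 i j w := by
      intro w
      simp only [hPnice, mul_add, Finset.mul_sum]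
    simp_rw [hdist]
    rw [integral_add ((((((((((I1.fun_add I2s).fun_add I3s).fun_add I4s).fun_add I5).fun_add I6).fun_add I7).fun_add
        I8).fun_add I9s).fun_add I10s).fun_add I11s) I12s,
      integral_add (((((((((I1.fun_add I2s).fun_add I3s).fun_add I4s).fun_add I5).fun_add I6).fun_add I7).fun_add
        I8).fun_add I9s).fun_add I10s) I11s,
      integral_add ((((((((I1.fun_add I2s).fun_add I3s).fun_add I4s).fun_add I5).fun_add I6).fun_add I7).fun_add
        I8).fun_add I9s) I10s,
      integral_add (((((((I1.fun_add I2s).fun_add I3s).fun_add I4s).fun_add I5).fun_add I6).fun_add I7).fun_add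
        I8) I9s,
      integral_add ((((((I1.fun_add I2s).fun_add I3s).fun_add I4s).fun_add I5).fun_add I6).fun_add I7) I8,
      integral_add (((((I1.fun_add I2s).fun_add I3s).fun_add I4s).fun_add I5).fun_add I6) I7,
      integral_add ((((I1.fun_add I2s).fun_add I3s).fun_add I4s).fun_add I5) I6,
      integral_add (((I1.fun_add I2s).fun_add I3s).fun_add I4s) I5,
      integral_add ((I1.fun_add I2s).fun_add I3s) I4s,
      integral_add (I1.fun_add I2s) I3s, integral_add I1 I2s,
      integral_finsetSum _ (fun i _ => I2 i), integral_finsetSum _ (fun i _ => I3 i),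
      integral_finsetSum _ (fun i _ => I4 i), integral_finsetSum _ (fun i _ => I9 i),
      integral_finsetSum _ (fun i _ => integrable_finsetSum _ fun j _ => I10 i j),
      integral_finsetSum _ (fun i _ => integrable_finsetSum _ fun j _ => I11 i j),
      integral_finsetSum _ (fun i _ => integrable_finsetSum _ fun j _ => I12 i j)]
    simp_rw [integral_finsetSum _ (fun j _ => I10 _ j), integral_finsetSum _ (fun j _ => I11 _ j),
      integral_finsetSum _ (fun j _ => I12 _ j)]
    -- the Calderón–Zygmund pieces
    have e10 : ∀ i j, ∫ w : ℝ × EuclideanSpace ℝ (Fin 3), θ w.1 w.2 * N10 i j w =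
        ∫ w : ℝ × EuclideanSpace ℝ (Fin 3), θ w.1 w.2 *
          (-(multiplierHeatPotential ν (oseenSymbol (b j) (b i) c) (G10 i j) w).re + heatPotential ν (H10 i j) w) :=
      fun i j => integral_congr_ae (AE10 hg i j)
    simp only [e10]
    rfl
  /- ### local integrability of the representative on `Q₃` -/
  have lPn : LocallyIntegrableOn Pnice Q₃ volume := by
    refine (locallyIntegrableOn_iff hQ₃o.isLocallyClosed).2 fun kk hkk hkkc => ?_
    have hkU : kk ⊆ U := hkk.trans hQ₃U
    have J1 : IntegrableOn P1 kk volume := lP1.integrableOn_isCompact hkkc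
    have J2 : ∀ i, IntegrableOn (P2 i) kk volume := fun i => (lP2 i).integrableOn_isCompact hkkc
    have J3 : ∀ i, IntegrableOn (P3 i) kk volume := fun i => (lP3 i).integrableOn_isCompact hkkc
    have J4 : ∀ i, IntegrableOn (P4 i) kk volume := fun i => (lP4 i).integrableOn_isCompact hkkc
    have J5 : IntegrableOn R5 kk volume := (sR5.continuousOn.mono hkU).integrableOn_compact hkkc
    have J6 : IntegrableOn P6 kk volume := lP6.integrableOn_isCompact hkkc
    have J7 : IntegrableOn P7 kk volume := lP7.integrableOn_isCompact hkkc
    have J8 : IntegrableOn R8 kk volume := (sR8.continuousOn.mono hkU).integrableOn_compact hkkc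
    have J9 : ∀ i, IntegrableOn (R9 i) kk volume := fun i => ((sR9 i).continuousOn.mono hkU).integrableOn_compact hkkc
    have J10 : ∀ i j, IntegrableOn (N10 i j) kk volume := fun i j => (lN10 i j).integrableOn_isCompact hkkc
    have J11 : ∀ i j, IntegrableOn (R11 i j) kk volume := fun i j =>
      ((sR11 i j).continuousOn.mono hkU).integrableOn_compact hkkc
    have J12 : ∀ i j, IntegrableOn (R12 i j) kk volume := fun i j =>
      ((sR12 i j).continuousOn.mono hkU).integrableOn_compact hkkc
    rw [hPnice]
    exact ((((((((((J1.fun_add (integrable_finsetSum _ fun i _ => J2 i)).fun_add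
      (integrable_finsetSum _ fun i _ => J3 i)).fun_add (integrable_finsetSum _ fun i _ => J4 i)).fun_add
      J5).fun_add J6).fun_add J7).fun_add J8).fun_add (integrable_finsetSum _ fun i _ => J9 i)).fun_add
      (integrable_finsetSum _ fun i _ => integrable_finsetSum _ fun j _ => J10 i j)).fun_add
      (integrable_finsetSum _ fun i _ => integrable_finsetSum _ fun j _ => J11 i j)).fun_add
      (integrable_finsetSum _ fun i _ => integrable_finsetSum _ fun j _ => J12 i j)
  have lu : LocallyIntegrableOn (fun w : ℝ × EuclideanSpace ℝ (Fin 3) => (⟪u w.1 w.2, c⟫ : ℝ)) Q₃ volume :=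
    (locallyIntegrableOn_iff hQ₃o.isLocallyClosed).2 fun kk hkk hkkc =>
      (hu.integrableOn_compact_subset (hkk.trans hQ₃Ω) hkkc).inner_const c
  /- ### the a.e. identity on `Q₃` -/
  have hae : ∀ᵐ w ∂(volume : Measure (ℝ × EuclideanSpace ℝ (Fin 3))), w ∈ Q₃ →
      (⟪u w.1 w.2, c⟫ : ℝ) - Pnice w = 0 := by
    refine hQ₃o.ae_eq_zero_of_integral_contDiff_smul_eq_zero (lu.sub lPn) fun g hgC hgc hgs => ?_
    set θ : ℝ → EuclideanSpace ℝ (Fin 3) → ℝ := fun t x => g (t, x) with hθ_def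
    have hug : uncurry θ = g := funext fun z => rfl
    have hθ : IsSpaceTimeTestOn (FluidPDE.parabolicCylinderCenteredOpens r₃ z₀) θ :=
      ⟨by rw [hug]; exact hgC, by rw [hug]; exact hgc, by rw [hug]; exact hgs⟩
    have hmain := MAIN θ hθ
    -- integrability of the two pieces against `g`
    have zg : ∀ z, z ∉ tsupport g → g z = 0 := fun z hz => image_eq_zero_of_notMem_tsupport hz
    have ig1 : Integrable (fun w : ℝ × EuclideanSpace ℝ (Fin 3) => g w * ⟪u w.1 w.2, c⟫) volume :=
      integrable_coeff_mul (T := g) (m := fun w => ⟪u w.1 w.2, c⟫) hgc hgC.continuous zg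
        (lu.integrableOn_compact_subset hgs hgc)
    have ig2 : Integrable (fun w : ℝ × EuclideanSpace ℝ (Fin 3) => g w * Pnice w) volume :=
      integrable_coeff_mul (T := g) (m := Pnice) hgc hgC.continuous zg (lPn.integrableOn_compact_subset hgs hgc)
    have e1 : ∫ w : ℝ × EuclideanSpace ℝ (Fin 3), g w * ⟪u w.1 w.2, c⟫ =
        ∫ w : ℝ × EuclideanSpace ℝ (Fin 3), θ w.1 w.2 * ⟪ut w, c⟫ := by
      refine integral_congr_ae ?_
      filter_upwards [(ae_restrict_iff' hΩm).1 hut] with w hw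
      by_cases hwΩ : w ∈ (Ω : Set (ℝ × EuclideanSpace ℝ (Fin 3)))
      · rw [hw hwΩ]
      · have : g w = 0 := zg w (fun h => hwΩ (hQ₃Ω (hgs h)))
        show g w * ⟪u w.1 w.2, c⟫ = g (w.1, w.2) * ⟪ut w, c⟫
        rw [show ((w.1, w.2) : ℝ × EuclideanSpace ℝ (Fin 3)) = w from rfl, this, zero_mul, zero_mul]
    calc ∫ w, g w • ((⟪u w.1 w.2, c⟫ : ℝ) - Pnice w)
        = ∫ w, (g w * ⟪u w.1 w.2, c⟫ - g w * Pnice w) := by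
          refine integral_congr_ae (Eventually.of_forall fun w => ?_)
          simp only [smul_eq_mul, mul_sub]
      _ = (∫ w, g w * ⟪u w.1 w.2, c⟫) - ∫ w, g w * Pnice w := integral_sub ig1 ig2
      _ = 0 := by rw [e1, hmain]; exact sub_self _
  /- ### the a.e. identification of the Calderón–Zygmund potential on `Q₃` -/
  have AE10' : ∀ i j, ∀ᵐ w ∂(volume : Measure (ℝ × EuclideanSpace ℝ (Fin 3))), w ∈ Q₃ →
      N10 i j w = -(multiplierHeatPotential ν (oseenSymbol (b j) (b i) c) (G10 i j) w).re +
        heatPotential ν (H10 i j) w := by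
    intro i j
    set g₃ : ℝ × EuclideanSpace ℝ (Fin 3) → ℝ := Q₃.indicator fun _ => (1 : ℝ) with hg₃
    have hQ₃fin : volume Q₃ < ∞ := volume_parabolicCylinderCentered_lt_top r₃ z₀
    have hgi : Integrable g₃ volume := by
      rw [hg₃, integrable_indicator_iff hQ₃o.measurableSet]
      exact integrableOn_const hQ₃fin.ne
    have hgM : ∀ᵐ w ∂(volume : Measure (ℝ × EuclideanSpace ℝ (Fin 3))), |g₃ w| ≤ 1 :=
      Eventually.of_forall fun w => by
        rw [hg₃]
        by_cases hw : w ∈ Q₃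
        · rw [indicator_of_mem hw]; simp
        · rw [indicator_of_notMem hw]; simp
    have hgsupp : ∀ᵐ w ∂(volume : Measure (ℝ × EuclideanSpace ℝ (Fin 3))), g₃ w ≠ 0 →
        w.1 ∈ Icc (z₀.1 - r₃ ^ 2) (z₀.1 + r₃ ^ 2) := Eventually.of_forall fun w hw => by
      have hwQ : w ∈ Q₃ := by
        by_contra h
        exact hw (by rw [hg₃, indicator_of_notMem h])
      rw [hQ₃_def, FluidPDE.mem_parabolicCylinderCentered] at hwQ
      exact ⟨hwQ.1.1.le, hwQ.1.2.le⟩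
    have hpair := (hK3 i j).integrable_kernelPairing_swap (iG10 i j) (TS (G10 i j) (zG10 i j)) hgi zero_le_one
      hgM hgsupp
    filter_upwards [hpair.prod_left_ae] with w hw hwQ
    have hg1 : g₃ w = 1 := by rw [hg₃, indicator_of_mem hwQ]
    have hw' : Integrable (fun z => backKernel
        (fun a y => heatD3 (ν * a) (b j) (b i) c (newtonNear r₀ r₁) y) (z - w) * G10 i j z) volume := by
      refine hw.congr (Eventually.of_forall fun z => ?_)
      show G10 i j z * (backKernel _ (z - w) * g₃ w) = _
      rw [hg1, mul_one, mul_comm]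
    simp only [hN10, hH10]
    exact convolution_reflect_backKernel_heatD3_newtonNear h₀ h₁ hν (hb1 j) (hb1 i) hc1 (mG10 i j) (iG10 i j) w hw'
  /- ### packing the data and the final assembly -/
  -- heat data
  let ι₁ := Unit ⊕ (Fin 3 ⊕ (Unit ⊕ (Unit ⊕ Fin 3 × Fin 3)))
  let e₁ : ι₁ ≃ Fin 15 := Fintype.equivFinOfCardEq card_heatIndex
  let Hd : ι₁ → ℝ × EuclideanSpace ℝ (Fin 3) → ℝ :=
    Sum.elim (fun _ => H1) (Sum.elim (fun i => H3 i) (Sum.elim (fun _ => H6) (Sum.elim (fun _ => H7)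
      (fun ij => H10 ij.1 ij.2))))
  let pd : ι₁ → ℝ := Sum.elim (fun _ => 3) (Sum.elim (fun _ => 3 / 2) (Sum.elim (fun _ => 10 / 7)
    (Sum.elim (fun _ => q₀) (fun _ => 3 / 2))))
  let qd : ι₁ → ℝ := Sum.elim (fun _ => 4) (Sum.elim (fun _ => 4) (Sum.elim (fun _ => min τ₀ 4)
    (Sum.elim (fun _ => 5 * q₀ / 2) (fun _ => 5 * (3 / 2) / 2))))
  have hHd : ∀ x : ι₁, IsHeatDatum T (pd x) (qd x) (Hd x) := by
    rintro (_ | i | _ | _ | ⟨i, j⟩)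
    · exact cls1
    · exact cls3 i
    · exact cls6
    · exact cls7
    · exact cls10 i j
  -- multiplier data
  let ι₂ := Fin 3 ⊕ (Fin 3 ⊕ Fin 3 × Fin 3)
  let e₂ : ι₂ ≃ Fin 15 := Fintype.equivFinOfCardEq card_multIndex
  let md : ι₂ → EuclideanSpace ℝ (Fin 3) → ℂ :=
    Sum.elim (fun i => derivSymbol (b i)) (Sum.elim (fun i => derivSymbol (b i)) (fun ij => oseenSymbol (b ij.2) (b ij.1) c))
  let gd : ι₂ → ℝ × EuclideanSpace ℝ (Fin 3) → ℝ :=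
    Sum.elim (fun i => M2 i) (Sum.elim (fun i => M4 i) (fun ij => M10 ij.1 ij.2))
  let p₂d : ι₂ → ℝ := Sum.elim (fun _ => 5 / 2) (Sum.elim (fun _ => 3 / 2) (fun _ => 3 / 2))
  let q₂d : ι₂ → ℝ := Sum.elim (fun _ => τ₂) (Sum.elim (fun _ => ρ') (fun _ => ρ'))
  have hgd : ∀ y : ι₂, IsMultiplierDatum T (p₂d y) (q₂d y) (md y) (gd y) := by
    rintro (i | i | ⟨i, j⟩)
    · exact clsM2 i
    · exact clsM4 i
    · exact clsM10 i j
  refine ⟨15, 15, fun n => Hd (e₁.symm n), fun n => pd (e₁.symm n), fun n => qd (e₁.symm n),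
    fun n => md (e₂.symm n), fun n => gd (e₂.symm n), fun n => p₂d (e₂.symm n), fun n => q₂d (e₂.symm n),
    R, Lip, fun n => hHd (e₁.symm n), fun n => hgd (e₂.symm n), hLip, ?_⟩
  -- the a.e. representation
  have hsum₁ : ∀ w : ℝ × EuclideanSpace ℝ (Fin 3),
      (∑ n : Fin 15, heatPotential ν (fun w' => ((Hd (e₁.symm n) w' : ℝ) : ℂ)) w).re =
        P1 w + ∑ i, P3 i w + P6 w + P7 w + ∑ i, ∑ j, heatPotential ν (H10 i j) w := by
    intro w
    rw [Equiv.sum_comp e₁.symm (fun x => heatPotential ν (fun w' => ((Hd x w' : ℝ) : ℂ)) w)]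
    simp only [Complex.re_sum, heatPotential_ofReal, Complex.ofReal_re]
    simp only [ι₁, Fintype.sum_sum_type, Fintype.sum_unique, Fintype.sum_prod_type, Hd, Sum.elim_inl, Sum.elim_inr,
      hP1, hP3, hP6, hP7]
    abel
  have hsum₂ : ∀ w : ℝ × EuclideanSpace ℝ (Fin 3),
      (∑ n : Fin 15, multiplierHeatPotential ν (md (e₂.symm n)) (gd (e₂.symm n)) w).re =
        ∑ i, P2 i w + ∑ i, P4 i w +
          ∑ i, ∑ j, (-(multiplierHeatPotential ν (oseenSymbol (b j) (b i) c) (G10 i j) w).re) := by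
    intro w
    rw [Equiv.sum_comp e₂.symm (fun y => multiplierHeatPotential ν (md y) (gd y) w)]
    simp only [Complex.re_sum]
    simp only [ι₂, Fintype.sum_sum_type, Fintype.sum_prod_type, md, gd, Sum.elim_inl, Sum.elim_inr]
    have e2 : ∀ i, (multiplierHeatPotential ν (derivSymbol (b i)) (M2 i) w).re = P2 i w := fun i => by
      rw [hM2F, multiplierHeatPotential_neg_datum, Complex.neg_re]
    have e4 : ∀ i, (multiplierHeatPotential ν (derivSymbol (b i)) (M4 i) w).re = P4 i w := fun i => by
      rw [hM4F, multiplierHeatPotential_neg_datum, Complex.neg_re]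
    have e10 : ∀ i j, (multiplierHeatPotential ν (oseenSymbol (b j) (b i) c) (M10 i j) w).re =
        -(multiplierHeatPotential ν (oseenSymbol (b j) (b i) c) (G10 i j) w).re := fun i j => by
      rw [hM10G, multiplierHeatPotential_neg_datum, Complex.neg_re]
    simp only [e2, e4, e10]
    abel
  rw [ae_restrict_iff' hQ₃o.measurableSet]
  have AEall : ∀ᵐ w ∂(volume : Measure (ℝ × EuclideanSpace ℝ (Fin 3))), ∀ i j, w ∈ Q₃ →
      N10 i j w = -(multiplierHeatPotential ν (oseenSymbol (b j) (b i) c) (G10 i j) w).re +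
        heatPotential ν (H10 i j) w :=
    ae_all_iff.2 fun i => ae_all_iff.2 fun j => AE10' i j
  filter_upwards [hae, AEall] with w h1 h2 hwQ
  have hu1 : (u w.1 w.2) k = ⟪u w.1 w.2, c⟫ := by
    rw [hc_def, hb_def, EuclideanSpace.inner_basisFun_real]
  rw [hu1, Complex.add_re, hsum₁ w, hsum₂ w]
  have h3 : (⟪u w.1 w.2, c⟫ : ℝ) = Pnice w := sub_eq_zero.1 (h1 hwQ)
  rw [h3]
  have h4 : ∑ i, ∑ j, N10 i j w =
      ∑ i, ∑ j, (-(multiplierHeatPotential ν (oseenSymbol (b j) (b i) c) (G10 i j) w).re) +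
        ∑ i, ∑ j, heatPotential ν (H10 i j) w := by
    rw [← Finset.sum_add_distrib]
    refine Finset.sum_congr rfl fun i _ => ?_
    rw [← Finset.sum_add_distrib]
    exact Finset.sum_congr rfl fun j _ => h2 i j hwQ
  simp only [hPnice, hR_def]
  rw [h4]
  ring

end LemarieRieusset2016

end Literature.Analysis.FluidPDE
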